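import Mathlib
import Literature.NumberTheory.LFunctions.Zhang2022.SkeletonPartTwo
import Literature.NumberTheory.LFunctions.Zhang2022.SkeletonAssembly
import Literature.NumberTheory.LFunctions.Zhang2022.Section11GaussTails
import HarnessLib

/-!
# Zhang (2022) typed at width, §11b: (11.5)–(11.6), Lemma 11.2 and its proof displays, and the
# `E₂` mean-square claim (PDF pp. 64–65, tex L3290–L3352)

Topic `Literature/NumberTheory/LFunctions/Zhang2022` (Landau–Siegel audit tree; verdict-neutral).
Y. Zhang, *Discrete mean estimates and the Landau–Siegel zero*, arXiv:2211.02515v1 (2022)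
[Zhang2022LandauSiegel] — **an unrefereed manuscript under adjudication. Every `def … : Prop` below
is a CLAIM OF THE MANUSCRIPT, STATED (with its page locator and DAG node id), NOT ASSERTED.**
Nothing here asserts or denies Theorems 1–2 of the source; typed ≠ discharged.

This file types, one declaration per DAG node (cell `siegel-zhang`, plan/DAG.tsv ids `Z22:…`), the
second half of §11 "Proof of Proposition 2.6": the displays from "It follows from Lemma 11.1 that
(11.5)" (p. 64) to "This follows by (8.25), (8.26) and simple estimates" (p. 65). The banked skeleton
nodes of this span are REFERENCED, never restated: Lemma 11.2 = `Skeleton.Lemma112`, its error term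
`E₂(s,ψ)` = `Skeleton.E2main`, (11.1) = `Skeleton.Eval111 c′`, the section-level deduction =
`Skeleton.Ded111 c′` (refined below by `DedProp26`), the objects `J₁, J₂, J̃₁, J̃₂(·,ψ̄), g̃₁, g̃₂, η_±,
f̃, g, 𝔠*, ω, Z(s,χψ)` = `Skeleton.J1, J2, Jtilde1, Jtilde2Bar, gtilde1, gtilde2, etaPM, ftilde, gW,
cstar, omegaW, Zpc`.

| decl | DAG node | locator | printed |
|---|---|---|---|
| `frakI1`, `frakI1Nat` | `Z22:§11.u018` | p. 64, tex L3295 | `𝔍₁ = (P^{0.5}η₋, P^{0.5}η₊) ∪ (P^{0.502}η₋, P^{0.502}η₊) ∪ (P^{0.504}η₋, P^{0.504}η₊)` |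
| `frakI1Sum` | (the sum in (11.5)) | p. 64, tex L3291 | `Σ_{n∈𝔍₁} χψ(n)n^{−s}(f̃(log n/log P) − g̃₁(n))` |
| `Eq115` | `Z22:(11.5)` | p. 64, tex L3291 | `J₁(s,ψ) − J̃₁(s,ψ) = Σ_{n∈𝔍₁} … + O(ε)` for `σ = 1/2` |
| `Step11u019` | `Z22:§11.u019` | p. 64, tex L3299 | `ΣΣ𝔠*|Σ_{n∈𝔍₁}…n^{−ρ}…|²ω = o(𝔞𝔓)` "by (11.3), (8.25) and (8.26)" |
| `Step11u020` | `Z22:§11.u020` | p. 64, tex L3303 | `ΣΣ𝔠*|J₁ − J̃₁|²ω = o(𝔞𝔓)` |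
| `Step11u021` | `Z22:§11.u021` | p. 64, tex L3307 | `ΣΣ𝔠*|J₂ − J̃₂|²ω = o(𝔞𝔓)` ("Similarly") |
| `Eq116` | `Z22:(11.6)` | p. 65, tex L3311 | `ΣΣ𝔠*|J̃₁ − Z(ρ,χψ)J̃₂(1−ρ,ψ̄)|²ω = o(𝔞𝔓)` |
| (reference) | `Z22:Lem11.2` | p. 65, tex L3319 | `Skeleton.Lemma112` (banked p409333) |
| `Step11u022`, `lemma112_iff_step11u022` | `Z22:§11.u022` | p. 65, tex L3320 | `J̃₁(s,ψ) = Z(s,χψ)J̃₂(1−s,ψ̄) + O(E₂(s,ψ))` (pointwise form) |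
| `step11u023` | `Z22:§11.u023` | p. 65, tex L3324 | `E(s,ψ) = 𝓛⁻⁶⁸∫_{−𝓛²⁰}^{𝓛²⁰}|Σ_{n<P₁}χψ(n)n^{−(s+iv)}|ω₁(iv)dv` (`= Skeleton.E2main`, `rfl`) |
| `Step11u024` | `Z22:§11.u024` | p. 65, tex L3330 | `Σ_nχψ(n)n^{−s}g(P^z/n) = L(s,χψ) − Z(s,χψ)Σ_nχψ̄(n)n^{−(1−s)}g(P^{1−z}Dt₀/n) + O(E₂)` |
| `Step11u025`, `Step11u026` | `Z22:§11.u025`, `u026` | p. 65, tex L3334, L3340 | the two `∫dz` identities over `[0.5,0.502]`, `[0.502,0.504]` |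
| `Step11u027` | `Z22:§11.u027` | p. 65, tex L3349 | `ΣΣ𝔠*E₂(ρ,ψ)²ω(ρ) = o(𝔞𝔓)` "by (8.25), (8.26) and simple estimates" |
| `DedLem112`, `DedStep11u025`, `DedStep11u026` | `Z22:Lem11.2.pf` | p. 65, tex L3329–L3346 | the proof of Lemma 11.2 as implications |
| `DedStep11u020`, `DedEq116`, `DedProp26` | `Z22:Prop2.6.pf` (refining `Skeleton.Ded111`) | pp. 64–65 | "Hence", "By Lemma 11.2 … reduced to", "therefore reduced to (11.6)" |
| `dedEq116_holds`, `dedProp26_holds` | `Z22:Prop2.6.pf` (two edges DISCHARGED) | p. 65 | the two "reduced to" steps are valid inferences (kernel-checked) |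
| `eval111_of_leaves`, `prop26_of_leaves` | `Z22:Prop2.6.pf` composed | pp. 62–65 | (11.1) and Prop. 2.6 from the §11b leaves + the edge `DedStep11u020` + §2 inputs + Lemma 8.1/Prop. 7.1 + (9.7) |
| `eq115_core`, `eq115_of`, `eq115_of_gtilde1_eq`, `eq115_printed` | `Z22:(11.5)` edge (DISCHARGED as an implication) | p. 64 | (11.5) from (11.2) of Lemma 11.1 and the tails sentence of p. 63, for any weight in place of `g̃₁`; `summable_Jtilde1_printed`, `abs_printedWeight_le`: the series of `J̃₁` converges for `σ = 1/2` ((4.3)) |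
| `scaleJ2`, `N2`, `frakI2Nat`, `frakI2Sum` | `Z22:§11.u021` made explicit (OBJECTS, unprinted) | p. 64, tex L3306 "Similarly" | `Yₙ = nP^{0.004}/(Dt₀)`, `𝔍₂ = {n : Yₙ ∈ 𝔍₁}`, `Σ_{n∈𝔍₂}χψ(n)n^{−s}(f̃(log n/log P + 0.004 − α̃) − g̃₂(n))`; exact identities `gtilde2_eq_gtilde1_scaleJ2` (`g̃₂(y) = g̃₁(Y)`), `tentArg_J2_eq`, `J2_eq_finsum_scaleJ2` |
| `Eq115J2`, `TailsJ2`, `Step11u019J2` | `Z22:§11.u021` made explicit (CLAIMS, unprinted) | p. 64, tex L3306 | the `J₂`-analogues of (11.5), of the tails sentence p. 63, of `Step11u019` asserted by "Similarly" |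
| `tailsJ2_holds`, `eq115J2_core`, `eq115J2_of`, `eq115J2_of_lemma111`, `summable_Jtilde2` | `Z22:§11.u021` inputs DISCHARGED | p. 64 | `TailsJ2` holds ((4.2)/(4.3) via `Section11GaussTails`); `Eq115J2` from Lemma 11.1 (`Lemma111 → Eq115J2`) |
| `DedStep11u021` | `Z22:Prop2.6.pf` (the "Similarly" edge) | p. 64 | `Step11u021` from `Eq115J2`, `Step11u019J2` and the same silent §2/§7/§8 inputs as `DedStep11u020` |

Conventions (cell plan/L3/ASSIGNMENTS.md §0, copied from the skeleton). The double sums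
`Σ_{ψ∈Ψ₁}Σ_{ρ∈Z̃(ψ)}` (printed here with `Z̃(ψ)`, elsewhere `𝔷(ψ)`, (2.14)) are the `Finset` sums over
`Skeleton.idx χ` with the real weights `Re 𝔠*(ρ,ψ)`, `Re ω(ρ)` exactly as in `Skeleton.xi3sq` (the
left side of (11.1)); "`X = o(𝔞𝔓)`" is `∀ ε > 0, ForAllLarge (A → X ≤ ε𝔞𝔓)` as in `Skeleton.Eval111`;
"`= … + O(E₂(s,ψ))`" is `∃ C, … ‖lhs − rhs‖ ≤ C·E₂(s,ψ)` as in `Skeleton.Lemma112`; the "`ε`" of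
(11.5) is the manuscript's `ε = exp{−c𝓛¹⁰}` (§4 p. 19, tex L1062) with an unspecified absolute
`c > 0`, typed `∃ c > 0, ∃ C, … ≤ C·exp(−c𝓛¹⁰)` as in `Skeleton.Lemma111`; every claim node carries
the section frame `ForAllLarge fun D _ χ => AssumptionA D χ → …` (§11 proves Proposition 2.6, which
assumes (A)). `χψ̄(n)` is `conj (pc χ x n)` (the skeleton's convention in `Jtilde2Bar`; `χ` is real).
The un-conjugated `J̃₂(ρ,ψ) = Σ_n χψ(n)g̃₂(n)n^{−ρ}` of the "Similarly" display (defined in print on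
p. 63, tex L3208, for `μ = 1, 2`) is written out inline from tree objects (`pc`, `gtilde2`); the tree
types only `J̃₂(w,ψ̄)` (`Jtilde2Bar`), and `J̃₂(ρ,ψ) = conj J̃₂(ρ̄,ψ̄)` termwise.

GAP candidates recorded by the cell (plan/GAP-LEDGER.md), typed here EXACTLY as printed and not
adjudicated: `Step11u019` and `Step11u027` are justified in print by "(8.25), (8.26)", displays that do
not exist in arXiv v1 (§8 ends at (8.24)); `Step11u021` is justified by "Similarly" (the `J₂`-analogue
of Lemma 11.1/(11.5) is not written out — section `J2Chain` below writes it out: Lemma 11.1 is a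
statement about a real variable and `g̃₂(y) = g̃₁(yP^{0.004}/(Dt₀))` exactly, so the (11.5)-analogue
`Eq115J2` and the `J₂`-tails `TailsJ2` are PROVED here from Lemma 11.1 and (4.2)/(4.3); what remains of
"Similarly" is the window mean square `Step11u019J2`, resting on the same missing "(8.25), (8.26)" as
`Step11u019`); `Step11u024` by "in a way similar to the proof of Lemma 6.1".
The deduction nodes make explicit the §2 inputs the one-word inferences use silently (non-negativity
of `𝔠*` on the zeros, Lemma 2.3 = `Skeleton.Lemma23`; zeros on the critical line, Prop. 2.2 (i) =
`Skeleton.Prop22i`, whence `ω(ρ) > 0`, `|Z(ρ,χψ)| = 1` (`Skeleton.PsiChiPrimitive`) and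
`1 − ρ = ρ̄`; `𝔞 ≫ 1` = `Skeleton.FrakALowerBound`; a total-mass bound for `ΣΣ𝔠*ω` via Lemma 8.1 /
Prop. 7.1 as in `Skeleton.Ded111`) — exactly the hypotheses of the banked `Skeleton.prop26_of_evals`.

Deliberately NOT here: (11.1)–(11.4), `g̃₁, g̃₂, J̃_μ, η_±`, the tails sentence "By (5) and (5)"
(p. 63) and Lemma 11.1 with its proof (cell file `TypedSection11A`, tex L3189–L3288; Lemma 11.1 is
kernel-proved there, `Typed.Sec11A.lemma111_of_P`, and the `J̃₁`-tails in `Section11TailsClaim`); the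
unconditional assemblies `eq115_holds`, `eq115J2_holds` (which import those files) live in
`Section11Eq115.lean`; §12.

## References

* Y. Zhang, arXiv:2211.02515v1 (2022), §11 pp. 64–65, displays (11.5), (11.6), Lemma 11.2;
  §4 p. 19 (`ε`), §2 (2.14)–(2.16), Lemma 2.3, Prop. 2.2. [cite: Zhang2022LandauSiegel, §11 pp. 64–65]
-/

noncomputable section

open Complex Real ComplexConjugate

namespace Literature.NumberTheory.LFunctions.Zhang2022.Typed.TypedSection11B

open Literature.NumberTheory.LFunctions.Zhang2022.Skeleton

/-! ## Objects: `𝔍₁` and the sum in (11.5) -/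

/-- `Z22:§11.u018` OBJECT. **`𝔍₁ = (P^{0.5}η₋, P^{0.5}η₊) ∪ (P^{0.502}η₋, P^{0.502}η₊) ∪
(P^{0.504}η₋, P^{0.504}η₊)`** (`η_± = exp{±𝓛⁻¹⁰}` = `Skeleton.etaPM D (±1)`), as a set of reals —
the three windows of (11.3). [Z22 p.64, (display after (11.5)), tex L3295]
[cite: Zhang2022LandauSiegel, §11 p. 64] -/
def frakI1 (D : ℕ) : Set ℝ :=
  Set.Ioo (bigP D ^ (0.5 : ℝ) * etaPM D (-1)) (bigP D ^ (0.5 : ℝ) * etaPM D 1) ∪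
    Set.Ioo (bigP D ^ (0.502 : ℝ) * etaPM D (-1)) (bigP D ^ (0.502 : ℝ) * etaPM D 1) ∪
    Set.Ioo (bigP D ^ (0.504 : ℝ) * etaPM D (-1)) (bigP D ^ (0.504 : ℝ) * etaPM D 1)

open scoped Classical in
/-- `Z22:§11.u018` OBJECT. The integers `n ∈ 𝔍₁` (the range of the sums "`Σ_{n∈𝔍₁}`" of (11.5) and
of the next display), as a `Finset`: all `n ≤ ⌈P₁η₊⌉` with `(n : ℝ) ∈ 𝔍₁` (every member of `𝔍₁` is
`< P^{0.504}η₊ = P₁η₊`, so nothing is cut off: `mem_frakI1Nat_iff`). [Z22 p.64, tex L3295]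
[cite: Zhang2022LandauSiegel, §11 p. 64] -/
def frakI1Nat (D : ℕ) : Finset ℕ :=
  (Finset.Icc 1 ⌈Skeleton.P1 D * etaPM D 1⌉₊).filter fun n => (n : ℝ) ∈ frakI1 D

/-- `Z22:§11.u018`. `𝔍₁` is the union of the three windows `(P^aη₋, P^aη₊)`, `a ∈ {0.5, 0.502, 0.504}`
— the form in which (11.3) is typed in `Skeleton.Lemma111`. [Z22 p.64, tex L3295]
[cite: Zhang2022LandauSiegel, §11 p. 64] -/
theorem mem_frakI1_iff (D : ℕ) (y : ℝ) :
    y ∈ frakI1 D ↔ ∃ a ∈ ({0.5, 0.502, 0.504} : Finset ℝ),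
      bigP D ^ a * etaPM D (-1) < y ∧ y < bigP D ^ a * etaPM D 1 := by
  simp only [frakI1, Set.mem_union, Set.mem_Ioo, Finset.mem_insert, Finset.mem_singleton,
    exists_eq_or_imp, exists_eq_left, or_assoc]

/-- `Z22:§11.u018`. Membership in the `Finset` form of `𝔍₁` is membership in `𝔍₁`: the cut-off
`n ≤ ⌈P₁η₊⌉` and `n ≥ 1` are automatic (`0 < P^{0.5}η₋`, `P^a ≤ P^{0.504}` for `P ≥ 1`).
[Z22 p.64, tex L3295] [cite: Zhang2022LandauSiegel, §11 p. 64] -/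
theorem mem_frakI1Nat_iff (D : ℕ) (n : ℕ) : n ∈ frakI1Nat D ↔ (n : ℝ) ∈ frakI1 D := by
  classical
  rw [frakI1Nat, Finset.mem_filter, Finset.mem_Icc]
  constructor
  · exact fun h => h.2
  · intro h
    have hP0 : 0 < bigP D := Real.exp_pos _
    have hP1 : 1 ≤ bigP D := Real.one_le_exp (pow_nonneg (Real.log_natCast_nonneg D) 9)
    have hmono : ∀ a : ℝ, a ≤ 0.504 → bigP D ^ a * etaPM D 1 ≤ Skeleton.P1 D * etaPM D 1 := fun a ha =>
      mul_le_mul_of_nonneg_right (Real.rpow_le_rpow_of_exponent_le hP1 ha) (Real.exp_pos _).le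
    have hlow : ∀ a : ℝ, 0 < bigP D ^ a * etaPM D (-1) := fun a =>
      mul_pos (Real.rpow_pos_of_pos hP0 a) (Real.exp_pos _)
    rw [frakI1, Set.mem_union, Set.mem_union, Set.mem_Ioo, Set.mem_Ioo, Set.mem_Ioo] at h
    have hn : (0 : ℝ) < n ∧ (n : ℝ) ≤ Skeleton.P1 D * etaPM D 1 := by
      rcases h with (h | h) | h
      · exact ⟨(hlow _).trans h.1, h.2.le.trans (hmono _ (by norm_num))⟩
      · exact ⟨(hlow _).trans h.1, h.2.le.trans (hmono _ (by norm_num))⟩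
      · exact ⟨(hlow _).trans h.1, h.2.le.trans (hmono _ le_rfl)⟩
    refine ⟨⟨?_, ?_⟩, by rwa [frakI1, Set.mem_union, Set.mem_union, Set.mem_Ioo, Set.mem_Ioo,
      Set.mem_Ioo]⟩
    · have : n ≠ 0 := by
        rintro rfl
        simp at hn
      exact Nat.one_le_iff_ne_zero.mpr this
    · exact_mod_cast hn.2.trans (Nat.le_ceil _)

section Pointwise

variable {D : ℕ} [NeZero D] (χ : DirichletCharacter ℂ D) (x : Chr D)

/-- `Z22:(11.5)` OBJECT (the right-hand sum of (11.5), also the inner sum of `Z22:§11.u019`):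
**`Σ_{n∈𝔍₁} χψ(n)n^{−s}(f̃(log n/log P) − g̃₁(n))`** (`f̃` = `Skeleton.ftilde` (2.28), `g̃₁` =
`Skeleton.gtilde1`, `χψ(n)` = `Skeleton.pc`). [Z22 p.64, (11.5), tex L3291]
[cite: Zhang2022LandauSiegel, §11 (11.5), p. 64] -/
def frakI1Sum (s : ℂ) : ℂ :=
  ∑ n ∈ frakI1Nat D, pc χ x n * (n : ℂ) ^ (-s) *
    ((ftilde (Real.log n / Real.log (bigP D)) : ℂ) - (gtilde1 D n : ℂ))

/-- `Z22:§11.u022` CLAIM (pointwise form of the first display of Lemma 11.2, with the `O`-constant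
`C` explicit): **`J̃₁(s,ψ) = Z(s,χψ)J̃₂(1−s,ψ̄) + O(E₂(s,ψ))`**, i.e.
`|J̃₁(s,ψ) − Z(s,χψ)J̃₂(1−s,ψ̄)| ≤ C·E₂(s,ψ)` (`Skeleton.Jtilde1`, `Zpc`, `Jtilde2Bar`, `E2main`).
Lemma 11.2 itself is the banked node `Skeleton.Lemma112` (this display for `σ = 1/2`,
`|t − 2πt₀| < 𝓛₁`, under (A), `D` large): `lemma112_iff_step11u022`. Typed by reference, not
re-asserted. [Z22 p.65, (display of Lemma 11.2), tex L3320]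
[cite: Zhang2022LandauSiegel, §11 Lemma 11.2, p. 65] -/
def Step11u022 (s : ℂ) (C : ℝ) : Prop :=
  ‖Jtilde1 χ x s - Zpc χ x s * Jtilde2Bar χ x (1 - s)‖ ≤ C * E2main χ x s

omit [NeZero D] in
/-- `Z22:§11.u023` (definition display of Lemma 11.2): **`E(s,ψ) = 𝓛⁻⁶⁸∫_{−𝓛²⁰}^{𝓛²⁰}
|Σ_{n<P₁} χψ(n)n^{−(s+iv)}| ω₁(iv)dv`** (printed `E`, used as `E₂`; `ω₁(iv) = exp(−v²/(4𝓛³⁰))`,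
§4 p. 17; `P₁ = P^{0.504}`) IS the tree object `Skeleton.E2main χ x s` — the printed formula,
checked against it by `rfl`. [Z22 p.65, (display of Lemma 11.2), tex L3324]
[cite: Zhang2022LandauSiegel, §11 Lemma 11.2, p. 65] -/
theorem step11u023 (s : ℂ) :
    E2main χ x s = (ell D ^ 68)⁻¹ * ∫ v in (-(ell D ^ 20))..(ell D ^ 20),
      ‖∑ n ∈ Finset.Ico 1 ⌈Skeleton.P1 D⌉₊, pc χ x n * (n : ℂ) ^ (-(s + v * I))‖ *
        Real.exp (-(v ^ 2) / (4 * ell D ^ 30)) := rfl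

omit [NeZero D] in
/-- `Z22:§11.u021` BRIDGE (for the discharger of `DedProp26`). The un-conjugated
`J̃₂(s,ψ) = Σ_n χψ(n)g̃₂(n)n^{−s}` written out in `Step11u021` (printed p. 63, tex L3208, `μ = 2`) is,
termwise, the conjugate of the tree's `J̃₂(s̄,ψ̄) = Skeleton.Jtilde2Bar χ x (conj s)` (`conj` commutes
with the series; `conj(n^{−w}) = n^{−w̄}` for `n ≥ 0`); on the critical line `s̄ = 1 − s`.
[Z22 p.63, (display defining `J̃_μ`), tex L3208] [cite: Zhang2022LandauSiegel, §11 p. 63] -/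
theorem conj_Jtilde2Bar_conj (s : ℂ) :
    conj (Jtilde2Bar χ x (conj s)) = ∑' n : ℕ, pc χ x n * (gtilde2 D n : ℂ) * (n : ℂ) ^ (-s) := by
  rw [Jtilde2Bar, Complex.conj_tsum]
  refine tsum_congr fun n => ?_
  have harg : (n : ℂ).arg ≠ π := by rw [Complex.natCast_arg]; exact Real.pi_ne_zero.symm
  have h1 : (n : ℂ) ^ (-conj s) = conj ((n : ℂ) ^ (-s)) := by
    rw [← map_neg, Complex.cpow_conj _ _ harg, Complex.conj_natCast]
  rw [map_mul, map_mul, Complex.conj_conj, Complex.conj_ofReal, h1, Complex.conj_conj]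

end Pointwise

/-- `Z22:Lem11.2` / `Z22:§11.u022` BRIDGE: the banked node `Skeleton.Lemma112` is, by definition,
the display `Step11u022` for `σ = 1/2`, `|t − 2πt₀| < 𝓛₁`, under (A), for all large `D`, with one
absolute `O`-constant. [Z22 p.65, Lemma 11.2, tex L3319] [cite: Zhang2022LandauSiegel, §11 Lemma 11.2, p. 65] -/
theorem lemma112_iff_step11u022 :
    Lemma112 ↔ ∃ C : ℝ, ForAllLarge fun D _ χ => AssumptionA D χ → ∀ x : Chr D, ∀ s : ℂ,
      s.re = 1 / 2 → |s.im - 2 * π * t0 D| < ell1 D → Step11u022 χ x s C :=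
  Iff.rfl

/-! ## The claims of pp. 64–65 -/

section Claims

variable (c' : ℝ)

/-- `Z22:(11.5)` CLAIM. "It follows from Lemma 11.1 that **`J₁(s,ψ) − J̃₁(s,ψ) =
Σ_{n∈𝔍₁} χψ(n)n^{−s}(f̃(log n/log P) − g̃₁(n)) + O(ε)`** (11.5) for `σ = 1/2`" — `ε = exp{−c𝓛¹⁰}`
(§4 p. 19) with an unspecified absolute `c > 0`; inputs in print: Lemma 11.1 (`Skeleton.Lemma111`,
(11.2) off the windows) and the tails sentence "By (5) and (5) [sic], for `σ = 1/2`, the terms with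
`n ≤ P^{0.5}η₋` or `n ≥ P^{0.504}η₊` in `J̃₁(s,ψ)` contribute `≪ ε`" (p. 63, tex L3216; cell file
`TypedSection11A`). `J₁` = `Skeleton.J1` (2.29), `J̃₁` = `Skeleton.Jtilde1`.
[Z22 p.64, (11.5), tex L3291] [cite: Zhang2022LandauSiegel, §11 (11.5), p. 64] -/
def Eq115 : Prop :=
  ∃ c : ℝ, 0 < c ∧ ∃ C : ℝ, ForAllLarge fun D _ χ => AssumptionA D χ → ∀ x : Chr D, ∀ s : ℂ,
    s.re = 1 / 2 → ‖(J1 χ x s - Jtilde1 χ x s) - frakI1Sum χ x s‖ ≤ C * Real.exp (-c * ell D ^ 10)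

/-- `Z22:§11.u019` CLAIM. "By (11.3), (8.25) and (8.26), **`Σ_{ψ∈Ψ₁}Σ_{ρ∈Z̃(ψ)} 𝔠*(ρ,ψ)
|Σ_{n∈𝔍₁} χψ(n)n^{−ρ}(f̃(log n/log P) − g̃₁(n))|² ω(ρ) = o(𝔞𝔓)`**." GAP CANDIDATE of the cell:
the cited displays (8.25), (8.26) DO NOT EXIST in arXiv v1 (§8 ends at (8.24)); (11.3) is the
`𝓛⁻¹⁰` bound of Lemma 11.1 on the windows `𝔍₁`. Typed exactly as displayed (weights `Re 𝔠*`, `Re ω`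
over `Skeleton.idx`, as in `Skeleton.xi3sq`); not adjudicated here.
[Z22 p.64, (display after (11.5)), tex L3299] [cite: Zhang2022LandauSiegel, §11 p. 64] -/
def Step11u019 : Prop :=
  ∀ ε : ℝ, 0 < ε → ForAllLarge fun D _ χ => AssumptionA D χ →
    ∑ i ∈ idx χ, (cstar c' D i.1 i.2).re * ‖frakI1Sum χ i.1 i.2‖ ^ 2 * (omegaW D i.2).re
      ≤ ε * frakA χ * frakP D

/-- `Z22:§11.u020` CLAIM. "Hence **`Σ_{ψ∈Ψ₁}Σ_{ρ∈Z̃(ψ)} 𝔠*(ρ,ψ)|J₁(ρ,ψ) − J̃₁(ρ,ψ)|²ω(ρ) = o(𝔞𝔓)`**"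
(from (11.5) and the preceding display; edge `DedStep11u020`).
[Z22 p.64, (2nd display after (11.5)), tex L3303] [cite: Zhang2022LandauSiegel, §11 p. 64] -/
def Step11u020 : Prop :=
  ∀ ε : ℝ, 0 < ε → ForAllLarge fun D _ χ => AssumptionA D χ →
    ∑ i ∈ idx χ, (cstar c' D i.1 i.2).re * ‖J1 χ i.1 i.2 - Jtilde1 χ i.1 i.2‖ ^ 2 * (omegaW D i.2).re
      ≤ ε * frakA χ * frakP D

/-- `Z22:§11.u021` CLAIM. "Similarly, **`Σ_{ψ∈Ψ₁}Σ_{ρ∈Z̃(ψ)} 𝔠*(ρ,ψ)|J₂(ρ,ψ) − J̃₂(ρ,ψ)|²ω(ρ)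
= o(𝔞𝔓)`**" — the `J₂`-analogue of `Step11u020`; its inputs (the analogues of Lemma 11.1, (11.5) and
`Step11u019` for `J₂`, `g̃₂`, the shifted tent `f̃(· + 0.004 − α̃)` of (2.30)) are NOT written out in
print. `J₂` = `Skeleton.J2`; `J̃₂(ρ,ψ) = Σ_n χψ(n)g̃₂(n)n^{−ρ}` (p. 63, tex L3208, `μ = 2`) is
written out from `Skeleton.pc`, `Skeleton.gtilde2` (the tree's `Jtilde2Bar χ x w` is `J̃₂(w,ψ̄)`;
termwise `J̃₂(ρ,ψ) = conj (Jtilde2Bar χ x (conj ρ))`).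
[Z22 p.64, (3rd display after (11.5)), tex L3307] [cite: Zhang2022LandauSiegel, §11 p. 64] -/
def Step11u021 : Prop :=
  ∀ ε : ℝ, 0 < ε → ForAllLarge fun D _ χ => AssumptionA D χ →
    ∑ i ∈ idx χ, (cstar c' D i.1 i.2).re *
        ‖J2 χ i.1 i.2 - ∑' n : ℕ, pc χ i.1 n * (gtilde2 D n : ℂ) * (n : ℂ) ^ (-i.2)‖ ^ 2 *
        (omegaW D i.2).re
      ≤ ε * frakA χ * frakP D

/-- `Z22:(11.6)` CLAIM (the reduced goal). "The proof of (11.1) is therefore reduced to showing that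
**`Σ_{ψ∈Ψ₁}Σ_{ρ∈Z̃(ψ)} 𝔠*(ρ,ψ)|J̃₁(ρ,ψ) − Z(ρ,χψ)J̃₂(1−ρ,ψ̄)|²ω(ρ) = o(𝔞𝔓)`** (11.6)"
(`Skeleton.Jtilde1`, `Zpc`, `Jtilde2Bar χ x (1 − ρ)` = `J̃₂(1−ρ,ψ̄)`); the reduction itself is the
edge `DedProp26`, (11.1) is `Skeleton.Eval111 c′`. [Z22 p.65, (11.6), tex L3311]
[cite: Zhang2022LandauSiegel, §11 (11.6), p. 65] -/
def Eq116 : Prop :=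
  ∀ ε : ℝ, 0 < ε → ForAllLarge fun D _ χ => AssumptionA D χ →
    ∑ i ∈ idx χ, (cstar c' D i.1 i.2).re *
        ‖Jtilde1 χ i.1 i.2 - Zpc χ i.1 i.2 * Jtilde2Bar χ i.1 (1 - i.2)‖ ^ 2 * (omegaW D i.2).re
      ≤ ε * frakA χ * frakP D

/-- `Z22:§11.u024` CLAIM (proof of Lemma 11.2, first display). "Suppose `0.5 ≤ z ≤ 0.504`. In a way
similar to the proof of Lemma 6.1, it can be deduced that **`Σ_n χψ(n)n^{−s}g(P^z/n) = L(s,χψ) −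
Z(s,χψ)Σ_n χψ̄(n)n^{−(1−s)}g(P^{1−z}Dt₀/n) + O(E₂(s,ψ))`**" — for `σ = 1/2`, `|t − 2πt₀| < 𝓛₁` (the
hypotheses of Lemma 11.2), the `O`-constant absolute (uniform in `z`, as the integration over `z` in
the next two displays requires). `g` = `Skeleton.gW` (4.1); `L(s,χψ)` = `(Skeleton.psiChi χ x).LFunction`
(`χψ` mod `Dp`); `χψ̄(n)` = `conj (pc χ x n)`; `Σ_n` over all `n ≥ 1` (the `n = 0` term of the
`tsum` vanishes: `0^{−s} = 0` for `s ≠ 0`). The proof by analogy (Lemma 6.1 = `Skeleton.Lemma61` is for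
`L(s,ψ)` with the weights `g*(P₄/n)`, `g*(T²/n)`) is not carried out in print.
[Z22 p.65, (1st display of the proof of Lemma 11.2), tex L3330]
[cite: Zhang2022LandauSiegel, §11 Lemma 11.2 (proof), p. 65] -/
def Step11u024 : Prop :=
  ∃ C : ℝ, ForAllLarge fun D _ χ => AssumptionA D χ → ∀ x : Chr D, ∀ s : ℂ, s.re = 1 / 2 →
    |s.im - 2 * π * t0 D| < ell1 D → ∀ z : ℝ, 0.5 ≤ z → z ≤ 0.504 →
      ‖(∑' n : ℕ, pc χ x n * (n : ℂ) ^ (-s) * (gW D (bigP D ^ z / (n : ℝ)) : ℂ)) -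
          ((psiChi χ x).LFunction s -
            Zpc χ x s * ∑' n : ℕ, conj (pc χ x n) * (n : ℂ) ^ (-(1 - s)) *
              (gW D (bigP D ^ (1 - z) * (D : ℝ) * t0 D / (n : ℝ)) : ℂ))‖
        ≤ C * E2main χ x s

/-- `Z22:§11.u025` CLAIM (proof of Lemma 11.2, "Hence"). **`∫_{0.5}^{0.502}{Σ_n χψ(n)n^{−s}g(P^z/n)}dz
= (1/500)L(s,χψ) − Z(s,χψ)∫_{0.498}^{0.5}{Σ_n χψ̄(n)n^{−(1−s)}g(P^zDt₀/n)}dz + O(E₂(s,ψ))`**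
(for `σ = 1/2`, `|t − 2πt₀| < 𝓛₁`; obtained from `Step11u024` by integrating over `z ∈ [0.5, 0.502]`
and substituting `z ↦ 1 − z` in the second term; edge `DedStep11u025`).
[Z22 p.65, (2nd display of the proof of Lemma 11.2), tex L3334]
[cite: Zhang2022LandauSiegel, §11 Lemma 11.2 (proof), p. 65] -/
def Step11u025 : Prop :=
  ∃ C : ℝ, ForAllLarge fun D _ χ => AssumptionA D χ → ∀ x : Chr D, ∀ s : ℂ, s.re = 1 / 2 →
    |s.im - 2 * π * t0 D| < ell1 D →
      ‖(∫ z in (0.5 : ℝ)..0.502,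
            ∑' n : ℕ, pc χ x n * (n : ℂ) ^ (-s) * (gW D (bigP D ^ z / (n : ℝ)) : ℂ)) -
          ((1 / 500 : ℂ) * (psiChi χ x).LFunction s -
            Zpc χ x s * ∫ z in (0.498 : ℝ)..0.5,
              ∑' n : ℕ, conj (pc χ x n) * (n : ℂ) ^ (-(1 - s)) *
                (gW D (bigP D ^ z * (D : ℝ) * t0 D / (n : ℝ)) : ℂ))‖
        ≤ C * E2main χ x s

/-- `Z22:§11.u026` CLAIM (proof of Lemma 11.2, "and"). **`∫_{0.502}^{0.504}{Σ_n χψ(n)n^{−s}g(P^z/n)}dz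
= (1/500)L(s,χψ) − Z(s,χψ)∫_{0.496}^{0.498}{Σ_n χψ̄(n)n^{−(1−s)}g(P^zDt₀/n)}dz + O(E₂(s,ψ))`**
(same provenance as `Step11u025`, window `[0.502, 0.504]`; edge `DedStep11u026`). "This completes the
proof": `J̃₁ = −500·(u025) + 500·(u026)` and `g̃₂` (p. 62) give Lemma 11.2 (edge `DedLem112`).
[Z22 p.65, (3rd display of the proof of Lemma 11.2), tex L3340]
[cite: Zhang2022LandauSiegel, §11 Lemma 11.2 (proof), p. 65] -/
def Step11u026 : Prop :=
  ∃ C : ℝ, ForAllLarge fun D _ χ => AssumptionA D χ → ∀ x : Chr D, ∀ s : ℂ, s.re = 1 / 2 →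
    |s.im - 2 * π * t0 D| < ell1 D →
      ‖(∫ z in (0.502 : ℝ)..0.504,
            ∑' n : ℕ, pc χ x n * (n : ℂ) ^ (-s) * (gW D (bigP D ^ z / (n : ℝ)) : ℂ)) -
          ((1 / 500 : ℂ) * (psiChi χ x).LFunction s -
            Zpc χ x s * ∫ z in (0.496 : ℝ)..0.498,
              ∑' n : ℕ, conj (pc χ x n) * (n : ℂ) ^ (-(1 - s)) *
                (gW D (bigP D ^ z * (D : ℝ) * t0 D / (n : ℝ)) : ℂ))‖
        ≤ C * E2main χ x s

/-- `Z22:§11.u027` CLAIM (the last display of §11). "By Lemma 11.2, the proof of (11.6) is reduced to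
showing that **`Σ_{ψ∈Ψ₁}Σ_{ρ∈Z̃(ψ)} 𝔠*(ρ,ψ)E₂(ρ,ψ)²ω(ρ) = o(𝔞𝔓)`**. This follows by (8.25), (8.26)
and simple estimates." GAP CANDIDATE of the cell: (8.25), (8.26) DO NOT EXIST in arXiv v1. `E₂` =
`Skeleton.E2main` (the `E(s,ψ)` of Lemma 11.2). Typed exactly as displayed; not adjudicated here.
[Z22 p.65, (last display of §11), tex L3349] [cite: Zhang2022LandauSiegel, §11 p. 65] -/
def Step11u027 : Prop :=
  ∀ ε : ℝ, 0 < ε → ForAllLarge fun D _ χ => AssumptionA D χ →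
    ∑ i ∈ idx χ, (cstar c' D i.1 i.2).re * E2main χ i.1 i.2 ^ 2 * (omegaW D i.2).re
      ≤ ε * frakA χ * frakP D

/-! ## The deductions of pp. 64–65 as named implications (CLAIMS of the manuscript) -/

/-- `Z22:Lem11.2.pf` CLAIM (edge inside the proof of Lemma 11.2): "Hence" — the first integrated
identity `Step11u025` from the approximate functional equation `Step11u024` (integrate over
`z ∈ [0.5, 0.502]`, `∫_{0.5}^{0.502}dz = 1/500`, substitute `z ↦ 1 − z`; interchange of `Σ_n` and
`∫dz`). [Z22 p.65, (proof of Lemma 11.2), tex L3329–L3337]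
[cite: Zhang2022LandauSiegel, §11 Lemma 11.2 (proof), p. 65] -/
def DedStep11u025 : Prop := Step11u024 → Step11u025

/-- `Z22:Lem11.2.pf` CLAIM (edge inside the proof of Lemma 11.2): "and" — the second integrated
identity `Step11u026` from `Step11u024` (window `[0.502, 0.504]`).
[Z22 p.65, (proof of Lemma 11.2), tex L3329–L3346] [cite: Zhang2022LandauSiegel, §11 Lemma 11.2 (proof), p. 65] -/
def DedStep11u026 : Prop := Step11u024 → Step11u026

/-- `Z22:Lem11.2.pf` CLAIM (the proof of Lemma 11.2 as ONE implication, leaf → banked node): from the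
approximate functional equation `Step11u024` ("similar to the proof of Lemma 6.1") the manuscript
obtains `Step11u025`, `Step11u026` and, since `J̃₁(s,ψ) = Σ_nχψ(n)n^{−s}(−500∫_{0.5}^{0.502} +
500∫_{0.502}^{0.504})g(P^z/n)dz` and `g̃₂(y) = −500∫_{0.496}^{0.498} + 500∫_{0.498}^{0.5} g(P^zDt₀/y)dz`
(p. 62), "This completes the proof" of Lemma 11.2 = `Skeleton.Lemma112`.
[Z22 p.65, (proof of Lemma 11.2), tex L3329–L3346] [cite: Zhang2022LandauSiegel, §11 Lemma 11.2 (proof), p. 65] -/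
def DedLem112 : Prop := Step11u024 → Lemma112

/-- `Z22:Prop2.6.pf` (part) CLAIM: the one-word deduction "Hence" on p. 64 — `Step11u020` from (11.5)
(`Eq115`) and `Step11u019` — with the inputs the manuscript uses silently made explicit, exactly as
in the banked `Skeleton.Ded111` / `Skeleton.prop26_of_evals`: `𝔠*(ρ,ψ) ≥ 0` on the zeros (Lemma 2.3
= `Skeleton.Lemma23 c′`); the zeros `ρ ∈ 𝔷(ψ)`, `ψ ∈ Ψ₁`, on `σ = 1/2` (Prop. 2.2 (i) =
`Skeleton.Prop22i`, so that (11.5), stated for `σ = 1/2`, applies at `s = ρ` and `ω(ρ) > 0`); a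
total-mass bound for `ΣΣ𝔠*ω` to absorb the `O(ε)²` term (Lemma 8.1, Prop. 7.1 =
`Skeleton.Lemma81 c′`, `Skeleton.Prop71 c′`, with the constant polynomial `A ≡ 1`); and `𝔞 ≫ 1`
(`Skeleton.FrakALowerBound`). [Z22 p.64, ("Hence"), tex L3302–L3305]
[cite: Zhang2022LandauSiegel, §11 p. 64] -/
def DedStep11u020 : Prop :=
  Lemma23 c' → Prop22i → Lemma81 c' → Prop71 c' → FrakALowerBound → Eq115 → Step11u019 c' →
    Step11u020 c'

/-- `Z22:Prop2.6.pf` (part) CLAIM: "By Lemma 11.2, the proof of (11.6) is reduced to showing that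
`ΣΣ𝔠*E₂²ω = o(𝔞𝔓)`" (p. 65) — (11.6) = `Eq116` from `Skeleton.Lemma112` and `Step11u027`, with the
silent inputs explicit: `𝔠* ≥ 0` (`Skeleton.Lemma23 c′`) and the zeros `ρ ∈ 𝔷(ψ)`, `ψ ∈ Ψ₁`, on
`σ = 1/2` (Prop. 2.2 (i) = `Skeleton.Prop22i`, so that Lemma 11.2 applies at `s = ρ` and `ω(ρ) > 0`).
[Z22 p.65, ("By Lemma 11.2 … reduced to"), tex L3348–L3351] [cite: Zhang2022LandauSiegel, §11 p. 65] -/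
def DedEq116 : Prop := Lemma23 c' → Prop22i → Lemma112 → Step11u027 c' → Eq116 c'

/-- `Z22:Prop2.6.pf` CLAIM (the section-level deduction of §11, refining `Skeleton.Ded111 c′`): "The
proof of (11.1) is therefore reduced to showing (11.6)" — (11.1) = `Skeleton.Eval111 c′` from
`Step11u020`, `Step11u021` and `Eq116` by `J₁ − ZJ₂(1−ρ,ψ̄) = (J₁ − J̃₁) + (J̃₁ − ZJ̃₂(1−ρ,ψ̄)) +
Z(J̃₂(1−ρ,ψ̄) − J₂(1−ρ,ψ̄))`, with the silent inputs explicit as in `Skeleton.prop26_of_evals`: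
`𝔠* ≥ 0` (`Skeleton.Lemma23 c′`); zeros on the critical line (`Skeleton.Prop22i`: `ω(ρ) > 0`,
`1 − ρ = ρ̄` so that `X(1−ρ,ψ̄) = conj X(ρ,ψ)` termwise); `|Z(ρ,χψ)| = 1` there (`χψ` primitive mod
`Dp`, `Skeleton.PsiChiPrimitive`). Composing with `DedStep11u020`, `DedEq116`, `DedLem112` leaves
exactly the leaves `Eq115`, `Step11u019`, `Step11u021`, `Step11u024`, `Step11u027` of §11b (plus
Lemma 11.1 and the tails sentence of §11a behind `Eq115`). Proposition 2.6 then follows by the banked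
kernel edge `Skeleton.prop26_of_evals` ((9.7) + Cauchy). [Z22 p.65, ("therefore reduced to"), tex L3310–L3312]
[cite: Zhang2022LandauSiegel, §11 pp. 64–65] -/
def DedProp26 : Prop :=
  Lemma23 c' → Prop22i → PsiChiPrimitive → Step11u020 c' → Step11u021 c' → Eq116 c' → Eval111 c'

end Claims

/-! ## Two of the deduction edges, kernel-checked (the manuscript's "reduced to" steps are sound
given their displayed inputs and the §2 inputs; the displayed inputs themselves stay CLAIMS) -/

section Edges

variable (c' : ℝ)

/-- Membership in the index set of the double sums unpacks to `ψ ∈ Ψ₁`, `ρ ∈ 𝔷(ψ)`.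
[cite: Zhang2022LandauSiegel, §2 (2.16)] -/
private theorem mem_idx {D : ℕ} [NeZero D] (χ : DirichletCharacter ℂ D) {i : (_ : Chr D) × ℂ}
    (hi : i ∈ idx χ) : i.1 ∈ PsiOne χ ∧ i.2 ∈ zeroSet D i.1 := by
  rw [idx, Finset.mem_sigma] at hi
  exact ⟨mem_of_mem_finsetOf hi.1, mem_of_mem_finsetOf hi.2⟩

/-- For nonnegative reals, `(a + b + c)² ≤ 3(a² + b² + c²)`. [folklore] -/
private theorem sq_add_three_le (a b c : ℝ) : (a + b + c) ^ 2 ≤ 3 * (a ^ 2 + b ^ 2 + c ^ 2) := by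
  nlinarith [sq_nonneg (a - b), sq_nonneg (b - c), sq_nonneg (a - c)]

/-- `Z22:Prop2.6.pf` (part) DISCHARGED EDGE: **`DedEq116 c′` holds** — "By Lemma 11.2, the proof of
(11.6) is reduced to showing that `ΣΣ𝔠*E₂²ω = o(𝔞𝔓)`" (p. 65) is a valid inference given Lemma 2.3
(`𝔠* ≥ 0` on the zeros) and Prop. 2.2 (i) (the zeros lie on `σ = 1/2`, where Lemma 11.2 applies and
`ω(ρ) > 0`): square the pointwise bound of Lemma 11.2 and sum with the nonnegative weights. The inputs
`Skeleton.Lemma112`, `Step11u027` remain CLAIMS. [Z22 p.65, ("By Lemma 11.2 … reduced to"), tex L3348–L3351]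
[cite: Zhang2022LandauSiegel, §11 p. 65] -/
theorem dedEq116_holds : DedEq116 c' := by
  intro h23 h22 h112 h27 ε hε
  obtain ⟨C, hC⟩ := h112
  set ε₁ : ℝ := ε / (C ^ 2 + 1) with hε₁
  have hε₁0 : 0 < ε₁ := by positivity
  obtain ⟨D₀, h⟩ := ((h22.and h23).and hC).and (h27 ε₁ hε₁0)
  refine ⟨max D₀ 3, fun D _ χ hD hq hp hA => ?_⟩
  have hD3 : 3 ≤ D := le_trans (le_max_right _ _) hD
  obtain ⟨⟨⟨h22', h23'⟩, h112'⟩, h27'⟩ := h D χ (le_trans (le_max_left _ _) hD) hq hp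
  have hre : ∀ i ∈ idx χ, i.2.re = 1 / 2 := fun i hi =>
    h22' i.1 (mem_idx χ hi).1 i.2 (mem_prodZeroSetOmega_of_mem_zeroSet χ (mem_idx χ hi).2)
  have him : ∀ i ∈ idx χ, |i.2.im - 2 * π * t0 D| < ell1 D := fun i hi => by
    obtain ⟨-, him', -⟩ := (mem_idx χ hi).2
    exact him'
  have hc : ∀ i ∈ idx χ, 0 ≤ (cstar c' D i.1 i.2).re := fun i hi =>
    (h23' i.1 (mem_idx χ hi).1 i.2 (mem_idx χ hi).2).2
  have hω : ∀ i ∈ idx χ, 0 ≤ (omegaW D i.2).re := fun i hi =>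
    (omegaW_re_pos hD3 (hre i hi)).1.le
  have hpt : ∀ i ∈ idx χ,
      ‖Jtilde1 χ i.1 i.2 - Zpc χ i.1 i.2 * Jtilde2Bar χ i.1 (1 - i.2)‖ ^ 2 ≤
        C ^ 2 * E2main χ i.1 i.2 ^ 2 := by
    intro i hi
    have h1 := h112' hA i.1 i.2 (hre i hi) (him i hi)
    calc ‖Jtilde1 χ i.1 i.2 - Zpc χ i.1 i.2 * Jtilde2Bar χ i.1 (1 - i.2)‖ ^ 2
        ≤ (C * E2main χ i.1 i.2) ^ 2 := pow_le_pow_left₀ (norm_nonneg _) h1 2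
      _ = C ^ 2 * E2main χ i.1 i.2 ^ 2 := by ring
  have h0 : 0 ≤ frakA χ * frakP D := mul_nonneg (frakA_nonneg χ) (frakP_nonneg D)
  have hCε : C ^ 2 * ε₁ ≤ ε := by
    rw [hε₁, mul_div_assoc', div_le_iff₀ (by positivity)]
    nlinarith [sq_nonneg C, hε.le]
  calc ∑ i ∈ idx χ, (cstar c' D i.1 i.2).re *
          ‖Jtilde1 χ i.1 i.2 - Zpc χ i.1 i.2 * Jtilde2Bar χ i.1 (1 - i.2)‖ ^ 2 * (omegaW D i.2).re
      ≤ ∑ i ∈ idx χ, (cstar c' D i.1 i.2).re * (C ^ 2 * E2main χ i.1 i.2 ^ 2) *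
          (omegaW D i.2).re :=
        Finset.sum_le_sum fun i hi =>
          mul_le_mul_of_nonneg_right (mul_le_mul_of_nonneg_left (hpt i hi) (hc i hi)) (hω i hi)
    _ = C ^ 2 * ∑ i ∈ idx χ, (cstar c' D i.1 i.2).re * E2main χ i.1 i.2 ^ 2 *
          (omegaW D i.2).re := by
        rw [Finset.mul_sum]
        exact Finset.sum_congr rfl fun i _ => by ring
    _ ≤ C ^ 2 * (ε₁ * frakA χ * frakP D) := mul_le_mul_of_nonneg_left (h27' hA) (sq_nonneg C)
    _ = (C ^ 2 * ε₁) * (frakA χ * frakP D) := by ring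
    _ ≤ ε * (frakA χ * frakP D) := mul_le_mul_of_nonneg_right hCε h0
    _ = ε * frakA χ * frakP D := by ring

/-- `DedEq116` — `_holds` alias of `dedEq116_holds` above under the fact's exact name (appended
2026-08-28, D-0026 bookkeeping: the proof term is the existing theorem of this file; no statement,
definition or attribute is edited; no new named fact; the ledger's debt table listed the fact
unproved). [cite: Zhang2022LandauSiegel, §11 p. 65] -/
theorem _root_.Literature.NumberTheory.LFunctions.Zhang2022.Typed.TypedSection11B.DedEq116_holds :
    DedEq116 c' :=
  _root_.Literature.NumberTheory.LFunctions.Zhang2022.Typed.TypedSection11B.dedEq116_holds (c' := c')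

/-- `Z22:Prop2.6.pf` DISCHARGED EDGE: **`DedProp26 c′` holds** — "The proof of (11.1) is therefore
reduced to showing (11.6)" (p. 65) is a valid inference given the two mean-square claims
`Step11u020`, `Step11u021` ("Hence", "Similarly"), (11.6), Lemma 2.3, Prop. 2.2 (i) and the
primitivity of `χψ`: on the critical line `J₂(1−ρ,ψ̄) = conj J₂(ρ,ψ)`, `J̃₂(1−ρ,ψ̄) = conj J̃₂(ρ,ψ)`
(`conj_Jtilde2Bar_conj`), `|Z(ρ,χψ)| = 1` (`Skeleton.pointwise_inputs`), so
`|J₁ − ZJ̄₂|² ≤ 3(|J₁ − J̃₁|² + |J̃₁ − ZJ̃₂(1−ρ,ψ̄)|² + |J₂ − J̃₂|²)` pointwise, and the three weighted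
sums are each `≤ (ε/9)𝔞𝔓` eventually. The inputs remain CLAIMS; with `DedStep11u020`, `DedEq116`,
`DedLem112` this refines `Skeleton.Ded111 c′`. [Z22 p.65, ("therefore reduced to"), tex L3310–L3312]
[cite: Zhang2022LandauSiegel, §11 pp. 64–65] -/
theorem dedProp26_holds : DedProp26 c' := by
  intro h23 h22 hprim h20 h21 h116 ε hε
  set ε₁ : ℝ := ε / 9 with hε₁
  have hε₁0 : 0 < ε₁ := by positivity
  obtain ⟨D₀, h⟩ := ((((h22.and h23).and (h20 ε₁ hε₁0)).and (h21 ε₁ hε₁0)).and (h116 ε₁ hε₁0))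
  refine ⟨max D₀ 3, fun D _ χ hD hq hp hA => ?_⟩
  have hD3 : 3 ≤ D := le_trans (le_max_right _ _) hD
  obtain ⟨⟨⟨⟨h22', h23'⟩, h20'⟩, h21'⟩, h116'⟩ := h D χ (le_trans (le_max_left _ _) hD) hq hp
  obtain ⟨hc, hω, hZ⟩ := pointwise_inputs c' χ hD3 h23' h22' (fun x => hprim D χ x hD3 hp)
  have hre : ∀ i ∈ idx χ, i.2.re = 1 / 2 := fun i hi =>
    h22' i.1 (mem_idx χ hi).1 i.2 (mem_prodZeroSetOmega_of_mem_zeroSet χ (mem_idx χ hi).2)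
  -- the pointwise decomposition on the critical line
  have key : ∀ i ∈ idx χ,
      ‖J1 χ i.1 i.2 - Zpc χ i.1 i.2 * conj (J2 χ i.1 i.2)‖ ^ 2 ≤
        3 * (‖J1 χ i.1 i.2 - Jtilde1 χ i.1 i.2‖ ^ 2 +
          ‖Jtilde1 χ i.1 i.2 - Zpc χ i.1 i.2 * Jtilde2Bar χ i.1 (1 - i.2)‖ ^ 2 +
          ‖J2 χ i.1 i.2 - ∑' n : ℕ, pc χ i.1 n * (gtilde2 D n : ℂ) * (n : ℂ) ^ (-i.2)‖ ^ 2) := by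
    intro i hi
    have h1ρ : 1 - i.2 = conj i.2 :=
      Complex.ext (by simp [hre i hi]; norm_num) (by simp)
    have hJ2t : Jtilde2Bar χ i.1 (1 - i.2) =
        conj (∑' n : ℕ, pc χ i.1 n * (gtilde2 D n : ℂ) * (n : ℂ) ^ (-i.2)) := by
      rw [h1ρ, ← conj_Jtilde2Bar_conj χ i.1 i.2, Complex.conj_conj]
    have hdec : J1 χ i.1 i.2 - Zpc χ i.1 i.2 * conj (J2 χ i.1 i.2) =
        (J1 χ i.1 i.2 - Jtilde1 χ i.1 i.2) +
          (Jtilde1 χ i.1 i.2 - Zpc χ i.1 i.2 * Jtilde2Bar χ i.1 (1 - i.2)) +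
          Zpc χ i.1 i.2 * (Jtilde2Bar χ i.1 (1 - i.2) - conj (J2 χ i.1 i.2)) := by ring
    have hthird : ‖Zpc χ i.1 i.2 * (Jtilde2Bar χ i.1 (1 - i.2) - conj (J2 χ i.1 i.2))‖ =
        ‖J2 χ i.1 i.2 - ∑' n : ℕ, pc χ i.1 n * (gtilde2 D n : ℂ) * (n : ℂ) ^ (-i.2)‖ := by
      rw [norm_mul, hZ i hi, one_mul, hJ2t, ← map_sub, Complex.norm_conj, norm_sub_rev]
    calc ‖J1 χ i.1 i.2 - Zpc χ i.1 i.2 * conj (J2 χ i.1 i.2)‖ ^ 2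
        ≤ (‖J1 χ i.1 i.2 - Jtilde1 χ i.1 i.2‖ +
            ‖Jtilde1 χ i.1 i.2 - Zpc χ i.1 i.2 * Jtilde2Bar χ i.1 (1 - i.2)‖ +
            ‖Zpc χ i.1 i.2 * (Jtilde2Bar χ i.1 (1 - i.2) - conj (J2 χ i.1 i.2))‖) ^ 2 := by
          rw [hdec]
          exact pow_le_pow_left₀ (norm_nonneg _) (norm_add₃_le) 2
      _ ≤ 3 * (‖J1 χ i.1 i.2 - Jtilde1 χ i.1 i.2‖ ^ 2 +
            ‖Jtilde1 χ i.1 i.2 - Zpc χ i.1 i.2 * Jtilde2Bar χ i.1 (1 - i.2)‖ ^ 2 +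
            ‖Zpc χ i.1 i.2 * (Jtilde2Bar χ i.1 (1 - i.2) - conj (J2 χ i.1 i.2))‖ ^ 2) :=
          sq_add_three_le _ _ _
      _ = _ := by rw [hthird]
  have h0 : 0 ≤ frakA χ * frakP D := mul_nonneg (frakA_nonneg χ) (frakP_nonneg D)
  have hS20 := h20' hA
  have hS21 := h21' hA
  have hS116 := h116' hA
  show xi3sq c' χ ≤ ε * frakA χ * frakP D
  calc xi3sq c' χ
      = ∑ i ∈ idx χ, (cstar c' D i.1 i.2).re *
          ‖J1 χ i.1 i.2 - Zpc χ i.1 i.2 * conj (J2 χ i.1 i.2)‖ ^ 2 * (omegaW D i.2).re := rfl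
    _ ≤ ∑ i ∈ idx χ, (cstar c' D i.1 i.2).re *
          (3 * (‖J1 χ i.1 i.2 - Jtilde1 χ i.1 i.2‖ ^ 2 +
            ‖Jtilde1 χ i.1 i.2 - Zpc χ i.1 i.2 * Jtilde2Bar χ i.1 (1 - i.2)‖ ^ 2 +
            ‖J2 χ i.1 i.2 - ∑' n : ℕ, pc χ i.1 n * (gtilde2 D n : ℂ) * (n : ℂ) ^ (-i.2)‖ ^ 2)) *
          (omegaW D i.2).re :=
        Finset.sum_le_sum fun i hi =>
          mul_le_mul_of_nonneg_right (mul_le_mul_of_nonneg_left (key i hi) (hc i hi).2)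
            (hω i hi).1.le
    _ = 3 * ((∑ i ∈ idx χ, (cstar c' D i.1 i.2).re * ‖J1 χ i.1 i.2 - Jtilde1 χ i.1 i.2‖ ^ 2 *
            (omegaW D i.2).re) +
          (∑ i ∈ idx χ, (cstar c' D i.1 i.2).re *
            ‖Jtilde1 χ i.1 i.2 - Zpc χ i.1 i.2 * Jtilde2Bar χ i.1 (1 - i.2)‖ ^ 2 *
            (omegaW D i.2).re) +
          (∑ i ∈ idx χ, (cstar c' D i.1 i.2).re *
            ‖J2 χ i.1 i.2 - ∑' n : ℕ, pc χ i.1 n * (gtilde2 D n : ℂ) * (n : ℂ) ^ (-i.2)‖ ^ 2 *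
            (omegaW D i.2).re)) := by
        rw [← Finset.sum_add_distrib, ← Finset.sum_add_distrib, Finset.mul_sum]
        exact Finset.sum_congr rfl fun i _ => by ring
    _ ≤ 3 * (ε₁ * frakA χ * frakP D + ε₁ * frakA χ * frakP D + ε₁ * frakA χ * frakP D) := by
        gcongr
    _ = ε * frakA χ * frakP D := by rw [hε₁]; ring

/-- `DedProp26` — `_holds` alias of `dedProp26_holds` above under the fact's exact name (appended
2026-08-28, D-0026 bookkeeping: the proof term is the existing theorem of this file; no statement,
definition or attribute is edited; no new named fact; the ledger's debt table listed the fact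
unproved). [cite: Zhang2022LandauSiegel, §11 pp. 64–65] -/
theorem _root_.Literature.NumberTheory.LFunctions.Zhang2022.Typed.TypedSection11B.DedProp26_holds :
    DedProp26 c' :=
  _root_.Literature.NumberTheory.LFunctions.Zhang2022.Typed.TypedSection11B.dedProp26_holds (c' := c')

/-- **§11 in the kernel, modulo its leaves** (`Z22:Prop2.6.pf` refined; cone leaf C30 =
`Skeleton.Ded111`): (11.1) = `Skeleton.Eval111 c′` follows from the five §11b LEAVES — (11.5) `Eq115`,
the mean squares `Step11u019` ("by (11.3), (8.25), (8.26)"), `Step11u021` ("Similarly"),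
`Step11u027` ("by (8.25), (8.26) and simple estimates") and Lemma 11.2 `Skeleton.Lemma112` — together
with Lemma 2.3, Prop. 2.2 (i), Lemma 8.1, Prop. 7.1, `𝔞 ≫ 1` (CLAIM nodes of the skeleton), the edge
`DedStep11u020 c′` ("Hence", p. 64; its discharge is the cell file `Section11Deductions`, seat sz-d36)
and the two edges proved above; `χψ` primitive is the tree's `Skeleton.psiChiPrimitive_holds`. The
leaves are NOT asserted. [Z22 pp.64–65, (11.5)–(11.6), tex L3290–L3352]
[cite: Zhang2022LandauSiegel, §11 pp. 64–65] -/
theorem eval111_of_leaves (h20 : DedStep11u020 c') (h23 : Lemma23 c') (h22 : Prop22i)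
    (h81 : Lemma81 c') (h71 : Prop71 c') (hfa : FrakALowerBound) (h115 : Eq115)
    (h19 : Step11u019 c') (h21 : Step11u021 c') (h112 : Lemma112) (h27 : Step11u027 c') :
    Eval111 c' :=
  dedProp26_holds c' h23 h22 psiChiPrimitive_holds (h20 h23 h22 h81 h71 hfa h115 h19) h21
    (dedEq116_holds c' h23 h22 h112 h27)

/-- **Proposition 2.6 modulo the §11b leaves and (9.7)**: compose `eval111_of_leaves` with the
banked kernel edge `Skeleton.prop26_of_evals` ("By the result of Section 9, `Ξ₁₂ ≪ 𝔞𝔓`. Hence, by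
Cauchy's inequality, …", p. 62). Nothing here asserts the leaves or Proposition 2.6.
[Z22 p.62, (11.1), tex L3189–L3199; pp.64–65] [cite: Zhang2022LandauSiegel, §11 pp. 62–65] -/
theorem prop26_of_leaves (h20 : DedStep11u020 c') (h23 : Lemma23 c') (h22 : Prop22i)
    (h81 : Lemma81 c') (h71 : Prop71 c') (hfa : FrakALowerBound) (h115 : Eq115)
    (h19 : Step11u019 c') (h21 : Step11u021 c') (h112 : Lemma112) (h27 : Step11u027 c')
    (h97 : Eval97 c') : Prop26 c' :=
  prop26_of_evals h22 h23 psiChiPrimitive_holds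
    (eval111_of_leaves c' h20 h23 h22 h81 h71 hfa h115 h19 h21 h112 h27) h97 hfa

end Edges

/-! ## The edge behind (11.5): `Eq115` from (11.2) (Lemma 11.1) and the tails sentence of p. 63

The manuscript's "It follows from Lemma 11.1 that (11.5)" uses: the support of `f̃` (`J₁` lives on
`P^{0.5} ≤ n ≤ P^{0.504}`), the tails sentence (the terms of `J̃₁` with `n ≤ P^{0.5}η₋` or
`n ≥ P^{0.504}η₊` are `O(ε)`), and (11.2) on the two closed ranges between the windows (at most
`P^{0.504}η₊ + 1` terms, each `O(ε)`, and `P^{0.504}e^{−c𝓛¹⁰} ≤ e^{−(c/2)𝓛¹⁰}` for `𝓛 ≥ 2/c`). The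
deduction is proved ONCE over an arbitrary weight `w` in place of `g̃₁` (`eq115_core`), so that it
serves both the banked `Skeleton.gtilde1` (whose interval-integral binder is being re-parenthesised in
place, cell STATUS 2026-08-25T23:49Z) and the printed weight written out. -/

section Eq115Edge

variable {D : ℕ}

/-- `𝓛 ≥ 2` for `D ≥ 9` (`log 9 > 2`). [folklore] -/
private theorem two_le_ell {D : ℕ} (hD : 9 ≤ D) : 2 ≤ ell D := by
  have h9 : (9 : ℝ) ≤ D := by exact_mod_cast hD
  have hlog : 2 < Real.log D := by
    calc (2 : ℝ) < Real.log 9 := by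
          rw [Real.lt_log_iff_exp_lt (by norm_num)]
          have h2 : Real.exp 2 = Real.exp 1 * Real.exp 1 := by rw [← Real.exp_add]; norm_num
          rw [h2]
          nlinarith [Real.exp_one_lt_d9, Real.exp_pos 1]
      _ ≤ Real.log D := Real.log_le_log (by norm_num) h9
  exact hlog.le


/-- `|χψ(n)| ≤ 1`. [folklore] -/
private theorem norm_pc_le_one [NeZero D] (χ : DirichletCharacter ℂ D) (x : Chr D) (n : ℕ) :
    ‖pc χ x n‖ ≤ 1 := by
  rw [pc, norm_mul]
  exact mul_le_one₀ (DirichletCharacter.norm_le_one _ _) (norm_nonneg _)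
    (DirichletCharacter.norm_le_one _ _)

/-- `|n^{−s}| ≤ 1` for `n ≥ 1`, `Re s = 1/2`. [folklore] -/
private theorem norm_cpow_neg_le_one {n : ℕ} (hn : 0 < n) {s : ℂ} (hs : s.re = 1 / 2) :
    ‖(n : ℂ) ^ (-s)‖ ≤ 1 := by
  rw [Complex.norm_natCast_cpow_of_pos hn, Complex.neg_re, hs]
  exact Real.rpow_le_one_of_one_le_of_nonpos (by exact_mod_cast hn) (by norm_num)

/-- `f̃(log n/log P) ≠ 0` forces `P^{0.5} ≤ n ≤ P^{0.504}` ((2.28): `f̃` vanishes off `[0.5, 0.504]`).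
[cite: Zhang2022LandauSiegel, §2 (2.28)] -/
private theorem ftilde_ne_zero_bounds (hL : 0 < ell D) {n : ℕ}
    (h : ftilde (Real.log n / Real.log (bigP D)) ≠ 0) :
    bigP D ^ (0.5 : ℝ) ≤ n ∧ (n : ℝ) ≤ bigP D ^ (0.504 : ℝ) := by
  have hlogP : Real.log (bigP D) = ell D ^ 9 := by rw [bigP, Real.log_exp]
  have hlogP0 : 0 < Real.log (bigP D) := by rw [hlogP]; positivity
  have hP0 : 0 < bigP D := Real.exp_pos _
  have hz : 0.5 ≤ Real.log n / Real.log (bigP D) ∧ Real.log n / Real.log (bigP D) ≤ 0.504 := by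
    unfold ftilde at h
    split_ifs at h with h1 h2
    · exact ⟨h1.1, by linarith [h1.2]⟩
    · exact ⟨by linarith [h2.1], h2.2⟩
    · exact absurd rfl h
  have hn0 : (0 : ℝ) < n := by
    rcases Nat.eq_zero_or_pos n with rfl | hpos
    · exfalso
      have h05 := hz.1
      rw [Nat.cast_zero, Real.log_zero, zero_div] at h05
      norm_num at h05
    · exact_mod_cast hpos
  constructor
  · have h05 := hz.1
    rw [le_div_iff₀ hlogP0] at h05
    calc bigP D ^ (0.5 : ℝ) = Real.exp (Real.log (bigP D) * 0.5) := Real.rpow_def_of_pos hP0 _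
      _ ≤ Real.exp (Real.log n) := Real.exp_le_exp.mpr (by linarith)
      _ = n := Real.exp_log hn0
  · have h504 := hz.2
    rw [div_le_iff₀ hlogP0] at h504
    calc (n : ℝ) = Real.exp (Real.log n) := (Real.exp_log hn0).symm
      _ ≤ Real.exp (Real.log (bigP D) * 0.504) := Real.exp_le_exp.mpr (by linarith)
      _ = bigP D ^ (0.504 : ℝ) := (Real.rpow_def_of_pos hP0 _).symm

/-- Outside the tails `n ≤ P^{0.5}η₋`, `n ≥ P^{0.504}η₊` one has `1 ≤ n ≤ ⌈P₁η₊⌉`. [folklore] -/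
private theorem mem_Icc_of_not_tail {n : ℕ}
    (h : ¬((n : ℝ) ≤ bigP D ^ (0.5 : ℝ) * etaPM D (-1) ∨ bigP D ^ (0.504 : ℝ) * etaPM D 1 ≤ (n : ℝ))) :
    n ∈ Finset.Icc 1 ⌈Skeleton.P1 D * etaPM D 1⌉₊ := by
  push Not at h
  have ha : 0 < bigP D ^ (0.5 : ℝ) * etaPM D (-1) :=
    mul_pos (Real.rpow_pos_of_pos (Real.exp_pos _) _) (Real.exp_pos _)
  rw [Finset.mem_Icc]
  constructor
  · have : (0 : ℝ) < n := ha.trans h.1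
    exact Nat.one_le_iff_ne_zero.mpr (by rintro rfl; simp at this)
  · exact_mod_cast (h.2.le.trans (Nat.le_ceil _) : (n : ℝ) ≤ ⌈Skeleton.P1 D * etaPM D 1⌉₊)

/-- A point of a window of `𝔍₁` is not in the tails. [folklore] -/
private theorem not_tail_of_mem_frakI1 (hL : 0 < ell D) {y : ℝ} (hy : y ∈ frakI1 D) :
    ¬(y ≤ bigP D ^ (0.5 : ℝ) * etaPM D (-1) ∨ bigP D ^ (0.504 : ℝ) * etaPM D 1 ≤ y) := by
  have hP1 : 1 ≤ bigP D := Real.one_le_exp (by positivity)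
  have hm : 0 < etaPM D (-1) := Real.exp_pos _
  have hp : 0 < etaPM D 1 := Real.exp_pos _
  have low : ∀ a : ℝ, 0.5 ≤ a → bigP D ^ (0.5 : ℝ) * etaPM D (-1) ≤ bigP D ^ a * etaPM D (-1) :=
    fun a ha => mul_le_mul_of_nonneg_right (Real.rpow_le_rpow_of_exponent_le hP1 ha) hm.le
  have high : ∀ a : ℝ, a ≤ 0.504 → bigP D ^ a * etaPM D 1 ≤ bigP D ^ (0.504 : ℝ) * etaPM D 1 :=
    fun a ha => mul_le_mul_of_nonneg_right (Real.rpow_le_rpow_of_exponent_le hP1 ha) hp.le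
  push Not
  rw [frakI1, Set.mem_union, Set.mem_union, Set.mem_Ioo, Set.mem_Ioo, Set.mem_Ioo] at hy
  rcases hy with (hy | hy) | hy
  · exact ⟨lt_of_le_of_lt (low _ le_rfl) hy.1, lt_of_lt_of_le hy.2 (high _ (by norm_num))⟩
  · exact ⟨lt_of_le_of_lt (low _ (by norm_num)) hy.1, lt_of_lt_of_le hy.2 (high _ (by norm_num))⟩
  · exact ⟨lt_of_le_of_lt (low _ (by norm_num)) hy.1, lt_of_lt_of_le hy.2 (high _ le_rfl)⟩

/-- A point that is neither in the tails nor in a window of `𝔍₁` lies in one of the two closed ranges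
of (11.2). [folklore] -/
private theorem range112_of_not_tail_not_mem {y : ℝ}
    (ht : ¬(y ≤ bigP D ^ (0.5 : ℝ) * etaPM D (-1) ∨ bigP D ^ (0.504 : ℝ) * etaPM D 1 ≤ y))
    (hw : y ∉ frakI1 D) :
    (bigP D ^ (0.5 : ℝ) * etaPM D 1 ≤ y ∧ y ≤ bigP D ^ (0.502 : ℝ) * etaPM D (-1)) ∨
      (bigP D ^ (0.502 : ℝ) * etaPM D 1 ≤ y ∧ y ≤ bigP D ^ (0.504 : ℝ) * etaPM D (-1)) := by
  push Not at ht
  rw [frakI1, Set.mem_union, Set.mem_union, Set.mem_Ioo, Set.mem_Ioo, Set.mem_Ioo] at hw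
  push Not at hw
  obtain ⟨⟨h1, h2⟩, h3⟩ := hw
  have hy1 : bigP D ^ (0.5 : ℝ) * etaPM D 1 ≤ y := h1 ht.1
  have hy3 : y ≤ bigP D ^ (0.504 : ℝ) * etaPM D (-1) := by
    by_contra hc
    push Not at hc
    exact absurd (h3 hc) (not_le.mpr ht.2)
  by_cases hmid : y ≤ bigP D ^ (0.502 : ℝ) * etaPM D (-1)
  · exact Or.inl ⟨hy1, hmid⟩
  · push Not at hmid
    exact Or.inr ⟨h2 hmid, hy3⟩

/-- `⌈P₁η₊⌉ ≤ 2e·P^{0.504}` for `𝓛 ≥ 1`. [folklore] -/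
private theorem ceil_P1_eta_le (hL : 1 ≤ ell D) :
    (⌈Skeleton.P1 D * etaPM D 1⌉₊ : ℝ) ≤ 2 * Real.exp 1 * Real.exp (0.504 * ell D ^ 9) := by
  have hP0 : 0 < bigP D := Real.exp_pos _
  have hP1eq : Skeleton.P1 D = Real.exp (0.504 * ell D ^ 9) := by
    rw [Skeleton.P1, bigP, Real.rpow_def_of_pos (Real.exp_pos _), Real.log_exp, mul_comm]
  have heta : etaPM D 1 ≤ Real.exp 1 := by
    rw [etaPM, one_mul]
    exact Real.exp_le_exp.mpr (inv_le_one_of_one_le₀ (one_le_pow₀ hL))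
  have hQ1 : 1 ≤ Real.exp (0.504 * ell D ^ 9) := Real.one_le_exp (by positivity)
  have he1 : 1 ≤ Real.exp 1 := Real.one_le_exp zero_le_one
  have hb0 : 0 ≤ Skeleton.P1 D * etaPM D 1 := mul_nonneg (Real.rpow_nonneg hP0.le _) (Real.exp_pos _).le
  calc (⌈Skeleton.P1 D * etaPM D 1⌉₊ : ℝ) ≤ Skeleton.P1 D * etaPM D 1 + 1 := (Nat.ceil_lt_add_one hb0).le
    _ ≤ Real.exp (0.504 * ell D ^ 9) * Real.exp 1 + 1 := by
        rw [hP1eq]; gcongr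
    _ ≤ 2 * Real.exp 1 * Real.exp (0.504 * ell D ^ 9) := by nlinarith

/-- The printed weight of `J̃₁` is at most `2g(P^{0.504}/y)` in absolute value for `y ≥ P^{0.504}`
(`g` increasing, `0 < g`). [cite: Zhang2022LandauSiegel, §4 after (4.1)] -/
theorem abs_printedWeight_le (hL : 0 < ell D) {y : ℝ} (hy : bigP D ^ (0.504 : ℝ) ≤ y) :
    |-500 * (∫ z in (0.5 : ℝ)..0.502, gW D (bigP D ^ z / y)) +
        500 * (∫ z in (0.502 : ℝ)..0.504, gW D (bigP D ^ z / y))|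
      ≤ 2 * gW D (bigP D ^ (0.504 : ℝ) / y) := by
  have hΛ : 0 < ell D ^ 30 := by positivity
  have hP1 : 1 ≤ bigP D := Real.one_le_exp (by positivity)
  have hP0 : 0 < bigP D := Real.exp_pos _
  have hy0 : 0 < y := lt_of_lt_of_le (Real.rpow_pos_of_pos hP0 _) hy
  have hG0 : 0 < gW D (bigP D ^ (0.504 : ℝ) / y) := GaussWeight.gWeight_pos hΛ _
  have hbound : ∀ z : ℝ, z ≤ 0.504 → ‖gW D (bigP D ^ z / y)‖ ≤ gW D (bigP D ^ (0.504 : ℝ) / y) := by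
    intro z hz
    have hpz : 0 < bigP D ^ z / y := div_pos (Real.rpow_pos_of_pos hP0 z) hy0
    have hgz : 0 < gW D (bigP D ^ z / y) := GaussWeight.gWeight_pos hΛ _
    rw [Real.norm_eq_abs, abs_of_pos hgz]
    exact GaussWeight.gWeight_mono hΛ hpz
      (div_le_div_of_nonneg_right (Real.rpow_le_rpow_of_exponent_le hP1 hz) hy0.le)
  have h1 : ‖∫ z in (0.5 : ℝ)..0.502, gW D (bigP D ^ z / y)‖ ≤
      gW D (bigP D ^ (0.504 : ℝ) / y) * |0.502 - 0.5| :=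
    intervalIntegral.norm_integral_le_of_norm_le_const fun z hz => hbound z (by
      rw [Set.uIoc_of_le (by norm_num)] at hz; linarith [hz.2])
  have h2 : ‖∫ z in (0.502 : ℝ)..0.504, gW D (bigP D ^ z / y)‖ ≤
      gW D (bigP D ^ (0.504 : ℝ) / y) * |0.504 - 0.502| :=
    intervalIntegral.norm_integral_le_of_norm_le_const fun z hz => hbound z (by
      rw [Set.uIoc_of_le (by norm_num)] at hz; exact hz.2)
  rw [Real.norm_eq_abs] at h1 h2
  have e1 : |(0.502 : ℝ) - 0.5| = 0.002 := by norm_num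
  have e2 : |(0.504 : ℝ) - 0.502| = 0.002 := by norm_num
  rw [e1] at h1
  rw [e2] at h2
  calc |-500 * (∫ z in (0.5 : ℝ)..0.502, gW D (bigP D ^ z / y)) +
          500 * (∫ z in (0.502 : ℝ)..0.504, gW D (bigP D ^ z / y))|
      ≤ |-500 * (∫ z in (0.5 : ℝ)..0.502, gW D (bigP D ^ z / y))| +
          |500 * (∫ z in (0.502 : ℝ)..0.504, gW D (bigP D ^ z / y))| := abs_add_le _ _
    _ = 500 * |∫ z in (0.5 : ℝ)..0.502, gW D (bigP D ^ z / y)| +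
          500 * |∫ z in (0.502 : ℝ)..0.504, gW D (bigP D ^ z / y)| := by
        rw [abs_mul, abs_mul]; norm_num
    _ ≤ 500 * (gW D (bigP D ^ (0.504 : ℝ) / y) * 0.002) +
          500 * (gW D (bigP D ^ (0.504 : ℝ) / y) * 0.002) := by gcongr
    _ = 2 * gW D (bigP D ^ (0.504 : ℝ) / y) := by ring

/-- **The series of `J̃₁(s,ψ)` (printed weight) converges absolutely for `σ = 1/2`** (`𝓛 ≥ 2`):
for `n ≥ eP^{0.504}`, (4.3) gives `|g̃₁(n)| ≤ 2g(P^{0.504}/n) ≤ exp{−𝓛³⁰log²(n/P^{0.504})} ≤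
(P^{0.504}/n)²`. [cite: Zhang2022LandauSiegel, §4 (4.3); §11 p. 63] -/
theorem summable_Jtilde1_printed [NeZero D] (χ : DirichletCharacter ℂ D) (hL : 2 ≤ ell D)
    (x : Chr D) {s : ℂ} (hs : s.re = 1 / 2) :
    Summable fun n : ℕ => pc χ x n *
      ((-500 * (∫ z in (0.5 : ℝ)..0.502, gW D (bigP D ^ z / n)) +
          500 * (∫ z in (0.502 : ℝ)..0.504, gW D (bigP D ^ z / n)) : ℝ) : ℂ) * (n : ℂ) ^ (-s) := by
  have hL0 : 0 < ell D := by linarith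
  have hΛ : 0 < ell D ^ 30 := by positivity
  have hΛ2 : (2 : ℝ) ≤ ell D ^ 30 :=
    le_trans (by norm_num) (pow_le_pow_left₀ (by norm_num) hL 30)
  set Q : ℝ := bigP D ^ (0.504 : ℝ) with hQ
  have hQ0 : 0 < Q := Real.rpow_pos_of_pos (Real.exp_pos _) _
  refine Summable.of_norm_bounded_eventually_nat
    ((Real.summable_one_div_nat_pow.mpr one_lt_two).mul_left (Q ^ 2)) ?_
  rw [Filter.eventually_atTop]
  refine ⟨⌈Real.exp 1 * Q⌉₊ + 1, fun n hn => ?_⟩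
  have hn0 : 0 < n := by omega
  have hn0' : (0 : ℝ) < n := by exact_mod_cast hn0
  have hnQ : Real.exp 1 * Q ≤ n := by
    have h1 := Nat.le_ceil (Real.exp 1 * Q)
    have h2 : ((⌈Real.exp 1 * Q⌉₊ + 1 : ℕ) : ℝ) ≤ n := by exact_mod_cast hn
    push_cast at h2
    linarith
  have he1 : 1 ≤ Real.exp 1 := Real.one_le_exp zero_le_one
  have hQn : Q ≤ n := le_trans (by nlinarith) hnQ
  have hu : 1 ≤ Real.log (n / Q) := by
    rw [Real.le_log_iff_exp_le (div_pos hn0' hQ0), le_div_iff₀ hQ0]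
    exact hnQ
  have hw := abs_printedWeight_le hL0 hQn
  have hgQn : 0 < gW D (Q / n) := GaussWeight.gWeight_pos hΛ _
  have hG : gW D (Q / n) ≤ 1 / 2 * Real.exp (-(ell D ^ 30) * (Real.log (Q / n)) ^ 2) :=
    GaussWeight.gWeight_le hΛ (div_pos hQ0 hn0') ((div_le_one hn0').mpr hQn)
  have hlog : Real.log (Q / n) = -Real.log (n / Q) := by
    rw [Real.log_div hQ0.ne' hn0'.ne', Real.log_div hn0'.ne' hQ0.ne']; ring
  have hexp : Real.exp (-(ell D ^ 30) * (Real.log (Q / n)) ^ 2) ≤ (Q / n) ^ 2 := by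
    rw [hlog, neg_sq]
    have hu0 : 0 ≤ Real.log (n / Q) := by linarith
    have h1 : -(ell D ^ 30) * Real.log (n / Q) ^ 2 ≤ -2 * Real.log (n / Q) := by nlinarith
    calc Real.exp (-(ell D ^ 30) * Real.log (n / Q) ^ 2)
        ≤ Real.exp (-2 * Real.log (n / Q)) := Real.exp_le_exp.mpr h1
      _ = Real.exp (-Real.log (n / Q)) ^ 2 := by rw [← Real.exp_nat_mul]; ring_nf
      _ = (Q / n) ^ 2 := by rw [Real.exp_neg, Real.exp_log (div_pos hn0' hQ0), inv_div]
  calc ‖pc χ x n * ((-500 * (∫ z in (0.5 : ℝ)..0.502, gW D (bigP D ^ z / n)) +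
            500 * (∫ z in (0.502 : ℝ)..0.504, gW D (bigP D ^ z / n)) : ℝ) : ℂ) * (n : ℂ) ^ (-s)‖
      = ‖pc χ x n‖ * |-500 * (∫ z in (0.5 : ℝ)..0.502, gW D (bigP D ^ z / n)) +
            500 * (∫ z in (0.502 : ℝ)..0.504, gW D (bigP D ^ z / n))| * ‖(n : ℂ) ^ (-s)‖ := by
        rw [norm_mul, norm_mul, Complex.norm_real, Real.norm_eq_abs]
    _ ≤ 1 * (2 * gW D (Q / n)) * 1 :=
        mul_le_mul (mul_le_mul (norm_pc_le_one χ x n) hw (abs_nonneg _) zero_le_one)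
          (norm_cpow_neg_le_one hn0 hs) (norm_nonneg _) (by linarith [hgQn])
    _ ≤ 2 * (1 / 2 * (Q / n) ^ 2) := by nlinarith [hG.trans (by nlinarith [hexp] : _ ≤ 1 / 2 * (Q / n) ^ 2)]
    _ = Q ^ 2 * (1 / (n : ℝ) ^ 2) := by field_simp

variable (c' : ℝ)

/-- **The deduction behind (11.5), over an arbitrary weight `w` in place of `g̃₁`**: if
`f̃(log y/log P) − w(y) = O(e^{−c𝓛¹⁰})` on the two closed ranges of (11.2), if the terms of
`Σ_n χψ(n)w(n)n^{−s}` with `n ≤ P^{0.5}η₋` or `n ≥ P^{0.504}η₊` have sum `O(e^{−c𝓛¹⁰})` (`σ = 1/2`),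
and if that series converges, then `J₁(s,ψ) − Σ_nχψ(n)w(n)n^{−s} = Σ_{n∈𝔍₁}χψ(n)n^{−s}(f̃ − w(n))
+ O(e^{−c'𝓛¹⁰})` for `σ = 1/2`: the at most `⌈P₁η₊⌉ ≤ 2eP^{0.504}` terms of the closed ranges
are each `O(e^{−c𝓛¹⁰})` and `P^{0.504}e^{−c𝓛¹⁰} ≤ e^{−(c/2)𝓛¹⁰}` once `𝓛 ≥ 2/c`.
[Z22 p.64, (11.5), tex L3290–L3296] [cite: Zhang2022LandauSiegel, §11 (11.5), p. 64] -/
theorem eq115_core (w : ℕ → ℝ → ℝ)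
    (h112 : ∃ c : ℝ, 0 < c ∧ ∃ C : ℝ, ForAllLarge fun D _ _ => ∀ y : ℝ,
      (bigP D ^ (0.5 : ℝ) * etaPM D 1 ≤ y ∧ y ≤ bigP D ^ (0.502 : ℝ) * etaPM D (-1)) ∨
          (bigP D ^ (0.502 : ℝ) * etaPM D 1 ≤ y ∧ y ≤ bigP D ^ (0.504 : ℝ) * etaPM D (-1)) →
        |ftilde (Real.log y / Real.log (bigP D)) - w D y| ≤ C * Real.exp (-c * ell D ^ 10))
    (htail : ∃ c : ℝ, 0 < c ∧ ∃ C : ℝ, ForAllLarge fun D _ χ => AssumptionA D χ → ∀ x : Chr D,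
      ∀ s : ℂ, s.re = 1 / 2 →
        ‖∑' n : ℕ, (if (n : ℝ) ≤ bigP D ^ (0.5 : ℝ) * etaPM D (-1) ∨
              bigP D ^ (0.504 : ℝ) * etaPM D 1 ≤ (n : ℝ)
            then pc χ x n * (w D n : ℂ) * (n : ℂ) ^ (-s) else 0)‖ ≤ C * Real.exp (-c * ell D ^ 10))
    (hsum : ForAllLarge fun D _ χ => ∀ x : Chr D, ∀ s : ℂ, s.re = 1 / 2 →
      Summable fun n : ℕ => pc χ x n * (w D n : ℂ) * (n : ℂ) ^ (-s)) :
    ∃ c : ℝ, 0 < c ∧ ∃ C : ℝ, ForAllLarge fun D _ χ => AssumptionA D χ → ∀ x : Chr D, ∀ s : ℂ,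
      s.re = 1 / 2 →
        ‖((∑ᶠ n : ℕ, pc χ x n * (n : ℂ) ^ (-s) * (ftilde (Real.log n / Real.log (bigP D)) : ℂ)) -
              ∑' n : ℕ, pc χ x n * (w D n : ℂ) * (n : ℂ) ^ (-s)) -
            ∑ n ∈ frakI1Nat D, pc χ x n * (n : ℂ) ^ (-s) *
              ((ftilde (Real.log n / Real.log (bigP D)) : ℂ) - (w D n : ℂ))‖
          ≤ C * Real.exp (-c * ell D ^ 10) := by
  classical
  obtain ⟨c₁, hc₁, C₁, h₁⟩ := h112
  obtain ⟨c₂, hc₂, C₂, h₂⟩ := htail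
  have hc0 : 0 < min (c₁ / 2) c₂ := lt_min (by linarith) hc₂
  refine ⟨min (c₁ / 2) c₂, hc0, 2 * Real.exp 1 * |C₁| + |C₂|, ?_⟩
  obtain ⟨D₀, h⟩ := (h₁.and h₂).and hsum
  refine ⟨max D₀ (max 9 ⌈Real.exp (2 / c₁)⌉₊), fun D _ χ hD hq hp hA x s hs => ?_⟩
  have hD₀ : D₀ ≤ D := le_trans (le_max_left _ _) hD
  have hD9 : 9 ≤ D := le_trans (le_trans (le_max_left _ _) (le_max_right _ _)) hD
  have hDc : ⌈Real.exp (2 / c₁)⌉₊ ≤ D := le_trans (le_trans (le_max_right _ _) (le_max_right _ _)) hD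
  have hL2 : 2 ≤ ell D := two_le_ell hD9
  have hL1 : 1 ≤ ell D := by linarith
  have hL0 : 0 < ell D := by linarith
  have hLc : 2 / c₁ ≤ ell D := by
    have hDpos : (0 : ℝ) < D := by exact_mod_cast lt_of_lt_of_le (by norm_num : 0 < 9) hD9
    have hexp : Real.exp (2 / c₁) ≤ D := le_trans (Nat.le_ceil _) (by exact_mod_cast hDc)
    exact (Real.le_log_iff_exp_le hDpos).mpr hexp
  obtain ⟨⟨h₁', h₂'⟩, hsum'⟩ := h D χ hD₀ hq hp
  have hSum := hsum' x s hs
  have hTail := h₂' hA x s hs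
  -- the summands
  set f : ℕ → ℂ := fun n => pc χ x n * (w D n : ℂ) * (n : ℂ) ^ (-s) with hf
  set F : ℕ → ℂ := fun n =>
    pc χ x n * (n : ℂ) ^ (-s) * (ftilde (Real.log n / Real.log (bigP D)) : ℂ) with hF
  -- the finite set of non-tail indices
  set S : Finset ℕ := (Finset.Icc 1 ⌈Skeleton.P1 D * etaPM D 1⌉₊).filter fun n : ℕ =>
    ¬((n : ℝ) ≤ bigP D ^ (0.5 : ℝ) * etaPM D (-1) ∨ bigP D ^ (0.504 : ℝ) * etaPM D 1 ≤ (n : ℝ))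
    with hSdef
  have hmemS : ∀ n : ℕ, n ∈ S ↔
      ¬((n : ℝ) ≤ bigP D ^ (0.5 : ℝ) * etaPM D (-1) ∨ bigP D ^ (0.504 : ℝ) * etaPM D 1 ≤ (n : ℝ)) := by
    intro n
    rw [hSdef, Finset.mem_filter]
    exact ⟨fun h => h.2, fun h => ⟨mem_Icc_of_not_tail h, h⟩⟩
  -- (i) `J₁` is the finite sum of `F` over `S`
  have hJ1 : (∑ᶠ n : ℕ, F n) = ∑ n ∈ S, F n := by
    apply finsum_eq_sum_of_support_subset
    intro n hn
    rw [Function.mem_support] at hn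
    rw [Finset.mem_coe, hmemS]
    have hft : ftilde (Real.log n / Real.log (bigP D)) ≠ 0 := by
      intro h0
      apply hn
      rw [hF]
      simp only [h0, Complex.ofReal_zero, mul_zero]
    obtain ⟨hlo, hhi⟩ := ftilde_ne_zero_bounds hL0 hft
    have hm1 : etaPM D (-1) < 1 := by
      rw [etaPM]; exact Real.exp_lt_one_iff.mpr (by
        have : (0:ℝ) < (ell D ^ 10)⁻¹ := by positivity
        linarith)
    have hp1 : 1 < etaPM D 1 := by
      rw [etaPM, one_mul]; exact Real.one_lt_exp_iff.mpr (by positivity)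
    have hP5 : 0 < bigP D ^ (0.5 : ℝ) := Real.rpow_pos_of_pos (Real.exp_pos _) _
    have hP504 : 0 < bigP D ^ (0.504 : ℝ) := Real.rpow_pos_of_pos (Real.exp_pos _) _
    push Not
    constructor
    · calc bigP D ^ (0.5 : ℝ) * etaPM D (-1) < bigP D ^ (0.5 : ℝ) * 1 :=
            mul_lt_mul_of_pos_left hm1 hP5
        _ = bigP D ^ (0.5 : ℝ) := mul_one _
        _ ≤ n := hlo
    · calc (n : ℝ) ≤ bigP D ^ (0.504 : ℝ) := hhi
        _ = bigP D ^ (0.504 : ℝ) * 1 := (mul_one _).symm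
        _ < bigP D ^ (0.504 : ℝ) * etaPM D 1 := mul_lt_mul_of_pos_left hp1 hP504
  -- (ii) `J̃₁` splits into the sum over `S` and the tails
  have hJt : (∑' n : ℕ, f n) = (∑ n ∈ S, f n) +
      ∑' n : ℕ, (if (n : ℝ) ≤ bigP D ^ (0.5 : ℝ) * etaPM D (-1) ∨
          bigP D ^ (0.504 : ℝ) * etaPM D 1 ≤ (n : ℝ) then f n else 0) := by
    rw [← hSum.sum_add_tsum_compl (s := S), tsum_subtype]
    congr 1
    refine tsum_congr fun n => ?_
    rw [Set.indicator_apply]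
    have : n ∈ ((S : Set ℕ)ᶜ) ↔ ((n : ℝ) ≤ bigP D ^ (0.5 : ℝ) * etaPM D (-1) ∨
        bigP D ^ (0.504 : ℝ) * etaPM D 1 ≤ (n : ℝ)) := by
      rw [Set.mem_compl_iff, Finset.mem_coe, hmemS, not_not]
    by_cases hc : (n : ℝ) ≤ bigP D ^ (0.5 : ℝ) * etaPM D (-1) ∨ bigP D ^ (0.504 : ℝ) * etaPM D 1 ≤ (n : ℝ)
    · rw [if_pos (this.mpr hc), if_pos hc]
    · rw [if_neg (fun h => hc (this.mp h)), if_neg hc]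
  -- (iii) `S` = windows ⊔ closed ranges
  have hW : S.filter (fun n : ℕ => (n : ℝ) ∈ frakI1 D) = frakI1Nat D := by
    ext n
    rw [Finset.mem_filter, hmemS, mem_frakI1Nat_iff]
    exact ⟨fun h => h.2, fun h => ⟨not_tail_of_mem_frakI1 hL0 h, h⟩⟩
  have hsplit : ∀ g : ℕ → ℂ, ∑ n ∈ S, g n =
      (∑ n ∈ frakI1Nat D, g n) + ∑ n ∈ S.filter (fun n : ℕ => (n : ℝ) ∉ frakI1 D), g n := by
    intro g
    rw [← hW, Finset.sum_filter_add_sum_filter_not]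
  -- (iv) the closed-range terms are each `O(ε)`
  have hR : ∀ n ∈ S.filter (fun n : ℕ => (n : ℝ) ∉ frakI1 D), ‖F n - f n‖ ≤ C₁ * Real.exp (-c₁ * ell D ^ 10) := by
    intro n hn
    rw [Finset.mem_filter, hmemS] at hn
    have hrange := range112_of_not_tail_not_mem hn.1 hn.2
    have hb := h₁' (n : ℝ) hrange
    have hn1 : 0 < n := (Finset.mem_Icc.mp (mem_Icc_of_not_tail hn.1)).1
    have e : F n - f n = pc χ x n * (n : ℂ) ^ (-s) *
        ((ftilde (Real.log n / Real.log (bigP D)) - w D n : ℝ) : ℂ) := by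
      rw [hF, hf]; push_cast; ring
    rw [e, norm_mul, norm_mul, Complex.norm_real, Real.norm_eq_abs]
    calc ‖pc χ x n‖ * ‖(n : ℂ) ^ (-s)‖ * |ftilde (Real.log n / Real.log (bigP D)) - w D n|
        ≤ 1 * 1 * (C₁ * Real.exp (-c₁ * ell D ^ 10)) :=
          mul_le_mul (mul_le_mul (norm_pc_le_one χ x n) (norm_cpow_neg_le_one hn1 hs)
            (norm_nonneg _) zero_le_one) hb (abs_nonneg _) (by norm_num)
      _ = C₁ * Real.exp (-c₁ * ell D ^ 10) := by ring
  -- (v) assemble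
  have halg : ((∑ᶠ n : ℕ, F n) - ∑' n : ℕ, f n) -
      ∑ n ∈ frakI1Nat D, pc χ x n * (n : ℂ) ^ (-s) *
        ((ftilde (Real.log n / Real.log (bigP D)) : ℂ) - (w D n : ℂ)) =
      (∑ n ∈ S.filter (fun n : ℕ => (n : ℝ) ∉ frakI1 D), (F n - f n)) -
        ∑' n : ℕ, (if (n : ℝ) ≤ bigP D ^ (0.5 : ℝ) * etaPM D (-1) ∨
          bigP D ^ (0.504 : ℝ) * etaPM D 1 ≤ (n : ℝ) then f n else 0) := by
    have hWin : ∑ n ∈ frakI1Nat D, pc χ x n * (n : ℂ) ^ (-s) *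
        ((ftilde (Real.log n / Real.log (bigP D)) : ℂ) - (w D n : ℂ)) =
        ∑ n ∈ frakI1Nat D, (F n - f n) := by
      refine Finset.sum_congr rfl fun n _ => ?_
      rw [hF, hf]; ring
    rw [hJ1, hJt, hsplit F, hsplit f, hWin, Finset.sum_sub_distrib, Finset.sum_sub_distrib]
    ring
  -- the two pieces
  have hNR : ((S.filter (fun n : ℕ => (n : ℝ) ∉ frakI1 D)).card : ℝ) ≤
      2 * Real.exp 1 * Real.exp (0.504 * ell D ^ 9) := by
    calc ((S.filter (fun n : ℕ => (n : ℝ) ∉ frakI1 D)).card : ℝ)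
        ≤ (Finset.Icc 1 ⌈Skeleton.P1 D * etaPM D 1⌉₊).card := by
          have hsub : S.filter (fun n : ℕ => (n : ℝ) ∉ frakI1 D) ⊆
              Finset.Icc 1 ⌈Skeleton.P1 D * etaPM D 1⌉₊ :=
            (Finset.filter_subset _ S).trans (by rw [hSdef]; exact Finset.filter_subset _ _)
          exact_mod_cast Finset.card_le_card hsub
      _ = ⌈Skeleton.P1 D * etaPM D 1⌉₊ := by simp
      _ ≤ 2 * Real.exp 1 * Real.exp (0.504 * ell D ^ 9) := ceil_P1_eta_le hL1
  have hsumR : ‖∑ n ∈ S.filter (fun n : ℕ => (n : ℝ) ∉ frakI1 D), (F n - f n)‖ ≤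
      2 * Real.exp 1 * Real.exp (0.504 * ell D ^ 9) * (|C₁| * Real.exp (-c₁ * ell D ^ 10)) := by
    have hC : C₁ * Real.exp (-c₁ * ell D ^ 10) ≤ |C₁| * Real.exp (-c₁ * ell D ^ 10) :=
      mul_le_mul_of_nonneg_right (le_abs_self _) (Real.exp_pos _).le
    calc ‖∑ n ∈ S.filter (fun n : ℕ => (n : ℝ) ∉ frakI1 D), (F n - f n)‖
        ≤ ∑ n ∈ S.filter (fun n : ℕ => (n : ℝ) ∉ frakI1 D), ‖F n - f n‖ := norm_sum_le _ _
      _ ≤ ∑ n ∈ S.filter (fun n : ℕ => (n : ℝ) ∉ frakI1 D), |C₁| * Real.exp (-c₁ * ell D ^ 10) :=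
          Finset.sum_le_sum fun n hn => (hR n hn).trans hC
      _ = ((S.filter (fun n : ℕ => (n : ℝ) ∉ frakI1 D)).card : ℝ) * (|C₁| * Real.exp (-c₁ * ell D ^ 10)) := by
          rw [Finset.sum_const, nsmul_eq_mul]
      _ ≤ 2 * Real.exp 1 * Real.exp (0.504 * ell D ^ 9) * (|C₁| * Real.exp (-c₁ * ell D ^ 10)) :=
          mul_le_mul_of_nonneg_right hNR (by positivity)
  -- exponent bookkeeping
  have hE1 : Real.exp (0.504 * ell D ^ 9) * Real.exp (-c₁ * ell D ^ 10) ≤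
      Real.exp (-(min (c₁ / 2) c₂) * ell D ^ 10) := by
    rw [← Real.exp_add]
    apply Real.exp_le_exp.mpr
    have hmin : min (c₁ / 2) c₂ ≤ c₁ / 2 := min_le_left _ _
    have h10 : ell D ^ 10 = ell D ^ 9 * ell D := by ring
    have h9 : 0 ≤ ell D ^ 9 := by positivity
    -- 0.504 L^9 ≤ (c₁/2) L^10 since c₁ L ≥ 2 ≥ 1.008
    have hcL : 2 ≤ c₁ * ell D := by
      have := mul_le_mul_of_nonneg_left hLc hc₁.le
      rwa [mul_div_cancel₀ _ hc₁.ne'] at this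
    nlinarith [mul_le_mul_of_nonneg_left hmin (by positivity : (0:ℝ) ≤ ell D ^ 10)]
  have hE2 : Real.exp (-c₂ * ell D ^ 10) ≤ Real.exp (-(min (c₁ / 2) c₂) * ell D ^ 10) := by
    apply Real.exp_le_exp.mpr
    have hmin : min (c₁ / 2) c₂ ≤ c₂ := min_le_right _ _
    nlinarith [mul_le_mul_of_nonneg_left hmin (by positivity : (0:ℝ) ≤ ell D ^ 10)]
  rw [halg]
  calc ‖(∑ n ∈ S.filter (fun n : ℕ => (n : ℝ) ∉ frakI1 D), (F n - f n)) -
          ∑' n : ℕ, (if (n : ℝ) ≤ bigP D ^ (0.5 : ℝ) * etaPM D (-1) ∨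
            bigP D ^ (0.504 : ℝ) * etaPM D 1 ≤ (n : ℝ) then f n else 0)‖
      ≤ ‖∑ n ∈ S.filter (fun n : ℕ => (n : ℝ) ∉ frakI1 D), (F n - f n)‖ +
          ‖∑' n : ℕ, (if (n : ℝ) ≤ bigP D ^ (0.5 : ℝ) * etaPM D (-1) ∨
            bigP D ^ (0.504 : ℝ) * etaPM D 1 ≤ (n : ℝ) then f n else 0)‖ := norm_sub_le _ _
    _ ≤ 2 * Real.exp 1 * Real.exp (0.504 * ell D ^ 9) * (|C₁| * Real.exp (-c₁ * ell D ^ 10)) +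
          |C₂| * Real.exp (-c₂ * ell D ^ 10) := by
        exact add_le_add hsumR
          (hTail.trans (mul_le_mul_of_nonneg_right (le_abs_self _) (Real.exp_pos _).le))
    _ = 2 * Real.exp 1 * |C₁| * (Real.exp (0.504 * ell D ^ 9) * Real.exp (-c₁ * ell D ^ 10)) +
          |C₂| * Real.exp (-c₂ * ell D ^ 10) := by ring
    _ ≤ 2 * Real.exp 1 * |C₁| * Real.exp (-(min (c₁ / 2) c₂) * ell D ^ 10) +
          |C₂| * Real.exp (-(min (c₁ / 2) c₂) * ell D ^ 10) :=
        add_le_add (mul_le_mul_of_nonneg_left hE1 (by positivity))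
          (mul_le_mul_of_nonneg_left hE2 (abs_nonneg _))
    _ = (2 * Real.exp 1 * |C₁| + |C₂|) * Real.exp (-(min (c₁ / 2) c₂) * ell D ^ 10) := by ring

/-- **`Z22:(11.5)` from its printed inputs, for the banked objects**: if the banked `Skeleton.gtilde1`
unfolds to the printed `−500∫_{0.5}^{0.502}g(P^z/y)dz + 500∫_{0.502}^{0.504}g(P^z/y)dz` (by `rfl`
once the skeleton's in-place re-parenthesisation lands), then Lemma 11.1 (`Skeleton.Lemma111`, of
which only (11.2) is used) and the tails sentence of p. 63 (typed as `Typed.Sec11A.TailsClaim` in the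
cell file `TypedSection11A`; restated verbatim as the hypothesis `htail`) imply (11.5) = `Eq115`.
[Z22 p.64, (11.5), tex L3290–L3296] [cite: Zhang2022LandauSiegel, §11 (11.5), p. 64] -/
theorem eq115_of_gtilde1_eq
    (hg : ∀ (D : ℕ) (y : ℝ), gtilde1 D y =
      -500 * (∫ z in (0.5 : ℝ)..0.502, gW D (bigP D ^ z / y)) +
        500 * (∫ z in (0.502 : ℝ)..0.504, gW D (bigP D ^ z / y)))
    (h111 : Lemma111)
    (htail : ∃ c : ℝ, 0 < c ∧ ∃ C : ℝ, ForAllLarge fun D _ χ => AssumptionA D χ → ∀ x : Chr D,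
      ∀ s : ℂ, s.re = 1 / 2 →
        ‖∑' n : ℕ, (if (n : ℝ) ≤ bigP D ^ (0.5 : ℝ) * etaPM D (-1) ∨
              bigP D ^ (0.504 : ℝ) * etaPM D 1 ≤ (n : ℝ)
            then pc χ x n * (gtilde1 D n : ℂ) * (n : ℂ) ^ (-s) else 0)‖
          ≤ C * Real.exp (-c * ell D ^ 10)) :
    Eq115 := by
  obtain ⟨c, hc, C, h⟩ := h111
  have h112 : ∃ c : ℝ, 0 < c ∧ ∃ C : ℝ, ForAllLarge fun D _ _ => ∀ y : ℝ,
      (bigP D ^ (0.5 : ℝ) * etaPM D 1 ≤ y ∧ y ≤ bigP D ^ (0.502 : ℝ) * etaPM D (-1)) ∨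
          (bigP D ^ (0.502 : ℝ) * etaPM D 1 ≤ y ∧ y ≤ bigP D ^ (0.504 : ℝ) * etaPM D (-1)) →
        |ftilde (Real.log y / Real.log (bigP D)) - gtilde1 D y| ≤ C * Real.exp (-c * ell D ^ 10) :=
    ⟨c, hc, C, h.mono fun D _ χ _ _ hD y hy => (hD y).1 hy⟩
  have hsum : ForAllLarge fun D _ χ => ∀ x : Chr D, ∀ s : ℂ, s.re = 1 / 2 →
      Summable fun n : ℕ => pc χ x n * (gtilde1 D n : ℂ) * (n : ℂ) ^ (-s) := by
    refine ⟨9, fun D _ χ hD _ _ x s hs => ?_⟩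
    have h := summable_Jtilde1_printed χ (two_le_ell hD) x hs
    simp only [← hg] at h
    exact h
  exact eq115_core gtilde1 h112 htail hsum

/-- **`Z22:(11.5)` for the printed weight, unconditionally in the inputs' names**: (11.2) AS PRINTED
(the cell's `Typed.Sec11A.Eq112P`, restated verbatim as `h112`) and the tails sentence AS PRINTED
(`Typed.Sec11A.TailsClaimP`, proved in the cell as `tailsClaimP_holds`; restated verbatim as `htail`)
give (11.5) with `J̃₁`, `g̃₁` written out over the printed weight. The convergence of the series of
`J̃₁` is `summable_Jtilde1_printed`. [Z22 p.64, (11.5), tex L3290–L3296]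
[cite: Zhang2022LandauSiegel, §11 (11.5), p. 64] -/
theorem eq115_printed
    (h112 : ∃ c : ℝ, 0 < c ∧ ∃ C : ℝ, ForAllLarge fun D _ _ => ∀ y : ℝ,
      (bigP D ^ (0.5 : ℝ) * etaPM D 1 ≤ y ∧ y ≤ bigP D ^ (0.502 : ℝ) * etaPM D (-1)) ∨
          (bigP D ^ (0.502 : ℝ) * etaPM D 1 ≤ y ∧ y ≤ bigP D ^ (0.504 : ℝ) * etaPM D (-1)) →
        |ftilde (Real.log y / Real.log (bigP D)) -
            (-500 * (∫ z in (0.5 : ℝ)..0.502, gW D (bigP D ^ z / y)) +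
              500 * (∫ z in (0.502 : ℝ)..0.504, gW D (bigP D ^ z / y)))|
          ≤ C * Real.exp (-c * ell D ^ 10))
    (htail : ∃ c : ℝ, 0 < c ∧ ∃ C : ℝ, ForAllLarge fun D _ χ => AssumptionA D χ → ∀ x : Chr D,
      ∀ s : ℂ, s.re = 1 / 2 →
        ‖∑' n : ℕ, (if (n : ℝ) ≤ bigP D ^ (0.5 : ℝ) * etaPM D (-1) ∨
              bigP D ^ (0.504 : ℝ) * etaPM D 1 ≤ (n : ℝ)
            then pc χ x n *
              ((-500 * (∫ z in (0.5 : ℝ)..0.502, gW D (bigP D ^ z / n)) +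
                  500 * (∫ z in (0.502 : ℝ)..0.504, gW D (bigP D ^ z / n)) : ℝ) : ℂ) *
                (n : ℂ) ^ (-s) else 0)‖
          ≤ C * Real.exp (-c * ell D ^ 10)) :
    ∃ c : ℝ, 0 < c ∧ ∃ C : ℝ, ForAllLarge fun D _ χ => AssumptionA D χ → ∀ x : Chr D, ∀ s : ℂ,
      s.re = 1 / 2 →
        ‖(J1 χ x s - ∑' n : ℕ, pc χ x n *
              ((-500 * (∫ z in (0.5 : ℝ)..0.502, gW D (bigP D ^ z / n)) +
                  500 * (∫ z in (0.502 : ℝ)..0.504, gW D (bigP D ^ z / n)) : ℝ) : ℂ) *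
                (n : ℂ) ^ (-s)) -
            ∑ n ∈ frakI1Nat D, pc χ x n * (n : ℂ) ^ (-s) *
              ((ftilde (Real.log n / Real.log (bigP D)) : ℂ) -
                ((-500 * (∫ z in (0.5 : ℝ)..0.502, gW D (bigP D ^ z / n)) +
                  500 * (∫ z in (0.502 : ℝ)..0.504, gW D (bigP D ^ z / n)) : ℝ) : ℂ))‖
          ≤ C * Real.exp (-c * ell D ^ 10) :=
  eq115_core (fun D y => -500 * (∫ z in (0.5 : ℝ)..0.502, gW D (bigP D ^ z / y)) +
      500 * (∫ z in (0.502 : ℝ)..0.504, gW D (bigP D ^ z / y))) h112 htail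
    ⟨9, fun _ _ χ hD _ _ x _ hs => summable_Jtilde1_printed χ (two_le_ell hD) x hs⟩

/-- **`Z22:(11.5)` from Lemma 11.1 and the tails sentence, banked names** (the skeleton's `gtilde1`
now unfolds to the printed weight by `rfl`, cell STATUS SKEL-RULING (A), p412644): `Skeleton.Lemma111`
(only (11.2) is used) and the tails sentence of p. 63 (the cell's `Typed.Sec11A.TailsClaim`, restated
verbatim as `htail`) imply (11.5) = `Eq115`. With the cell's discharges of Lemma 11.1 and of the
tails sentence this makes (11.5) a theorem; the inputs are NOT asserted here.
[Z22 p.64, (11.5), tex L3290–L3296] [cite: Zhang2022LandauSiegel, §11 (11.5), p. 64] -/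
theorem eq115_of (h111 : Lemma111)
    (htail : ∃ c : ℝ, 0 < c ∧ ∃ C : ℝ, ForAllLarge fun D _ χ => AssumptionA D χ → ∀ x : Chr D,
      ∀ s : ℂ, s.re = 1 / 2 →
        ‖∑' n : ℕ, (if (n : ℝ) ≤ bigP D ^ (0.5 : ℝ) * etaPM D (-1) ∨
              bigP D ^ (0.504 : ℝ) * etaPM D 1 ≤ (n : ℝ)
            then pc χ x n * (gtilde1 D n : ℂ) * (n : ℂ) ^ (-s) else 0)‖
          ≤ C * Real.exp (-c * ell D ^ 10)) :
    Eq115 :=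
  eq115_of_gtilde1_eq (fun _ _ => rfl) h111 htail

/-- **The series of the banked `J̃₁(s,ψ) = Skeleton.Jtilde1` converges for `σ = 1/2`** (`𝓛 ≥ 2`),
from (4.3) (`summable_Jtilde1_printed`; `Skeleton.gtilde1` is the printed weight by `rfl`).
[Z22 p.63, tex L3209; §4 (4.3)] [cite: Zhang2022LandauSiegel, §11 p. 63] -/
theorem summable_Jtilde1 [NeZero D] (χ : DirichletCharacter ℂ D) (hL : 2 ≤ ell D) (x : Chr D)
    {s : ℂ} (hs : s.re = 1 / 2) :
    Summable fun n : ℕ => pc χ x n * (gtilde1 D n : ℂ) * (n : ℂ) ^ (-s) :=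
  summable_Jtilde1_printed χ hL x hs

end Eq115Edge

/-! ## "Similarly" (p. 64, tex L3306): the `J₂`-chain is the `J₁`-chain at the scaled points

`g̃₂(y) = g̃₁(yP^{0.004}/(Dt₀))` and `f̃(log n/log P + 0.004 − α̃) = f̃(log(nP^{0.004}/(Dt₀))/log P)`
(exact identities, proved below), so Lemma 11.1 — a statement about a REAL variable — applies to the
`J₂`-objects verbatim at `Yₙ = nP^{0.004}/(Dt₀)`. The word "Similarly" asserts the unprinted analogues
of (11.5) and of the window mean square (`Eq115J2`, `Step11u019J2`, with the tails sentence `TailsJ2`);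
they are typed here as CLAIMS (unprinted, stated not asserted), and the analogue of the (11.5)
deduction is PROVED (`eq115J2_of`). -/

section J2Chain

variable {D : ℕ}

/-- OBJECT (unprinted; (2.30)): the scaling **`y ↦ yP^{0.004}/(Dt₀)`** carrying the `J₂`-objects
onto the `J₁`-objects (`α̃ = log(Dt₀)/log P`). [Z22 p.10, (2.30), tex L560]
[cite: Zhang2022LandauSiegel, §2 (2.30)] -/
def scaleJ2 (D : ℕ) (y : ℝ) : ℝ := y * bigP D ^ (0.004 : ℝ) / ((D : ℝ) * t0 D)

/-- `Dt₀ > 0` for `D ≥ 2`. [folklore] -/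
private theorem D_mul_t0_pos (hD : 2 ≤ D) : 0 < (D : ℝ) * t0 D := by
  have hD' : (2 : ℝ) ≤ D := by exact_mod_cast hD
  have hℓ : 0 < ell D := Real.log_pos (by linarith)
  exact mul_pos (by linarith) (pow_pos hℓ _)

/-- The scaling `y ↦ yP^{0.004}/(Dt₀)` of (2.30) is positive on positive reals (`D ≥ 2`).
[cite: Zhang2022LandauSiegel, §2 (2.30)] -/
theorem scaleJ2_pos (hD : 2 ≤ D) {y : ℝ} (hy : 0 < y) : 0 < scaleJ2 D y :=
  div_pos (mul_pos hy (Real.rpow_pos_of_pos (Real.exp_pos _) _)) (D_mul_t0_pos hD)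

/-- `log(yP^{0.004}/(Dt₀)) = log y + 0.004𝓛⁹ − log(Dt₀)` for the scaling of (2.30) (`y > 0`, `D ≥ 2`;
`log P = 𝓛⁹`, (2.6)). [cite: Zhang2022LandauSiegel, §2 (2.30), (2.6)] -/
theorem log_scaleJ2 (hD : 2 ≤ D) {y : ℝ} (hy : 0 < y) :
    Real.log (scaleJ2 D y) = Real.log y + 0.004 * ell D ^ 9 - Real.log ((D : ℝ) * t0 D) := by
  have hP0 : 0 < bigP D := Real.exp_pos _
  rw [scaleJ2, Real.log_div (mul_pos hy (Real.rpow_pos_of_pos hP0 _)).ne' (D_mul_t0_pos hD).ne',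
    Real.log_mul hy.ne' (Real.rpow_pos_of_pos hP0 _).ne', Real.log_rpow hP0, bigP, Real.log_exp]

/-- `Dt₀ ≤ e^{520𝓛}` (`D = e^𝓛`, `t₀ = 𝓛⁵¹⁹ ≤ e^{519𝓛}`; `𝓛 ≥ 1`, `D ≥ 2`). [folklore] -/
private theorem D_mul_t0_le_exp (hD : 2 ≤ D) (hL : 1 ≤ ell D) :
    (D : ℝ) * t0 D ≤ Real.exp (520 * ell D) := by
  have hD0 : (0 : ℝ) < D := by exact_mod_cast (by omega : 0 < D)
  have hDeq : (D : ℝ) = Real.exp (ell D) := by rw [ell, Real.exp_log hD0]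
  have ht0 : t0 D ≤ Real.exp (519 * ell D) := by
    rw [t0]
    calc ell D ^ 519 ≤ Real.exp (ell D) ^ 519 :=
          pow_le_pow_left₀ (by linarith) (by linarith [Real.add_one_le_exp (ell D)]) 519
      _ = Real.exp (519 * ell D) := by rw [← Real.exp_nat_mul]; norm_num
  calc (D : ℝ) * t0 D ≤ (D : ℝ) * Real.exp (519 * ell D) := mul_le_mul_of_nonneg_left ht0 hD0.le
    _ = Real.exp (520 * ell D) := by rw [hDeq, ← Real.exp_add]; ring_nf

/-- `log(Dt₀) ≤ 520𝓛` (`𝓛 ≥ 1`, `D ≥ 2`). [folklore] -/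
private theorem log_D_mul_t0_le (hD : 2 ≤ D) (hL : 1 ≤ ell D) :
    Real.log ((D : ℝ) * t0 D) ≤ 520 * ell D := by
  calc Real.log ((D : ℝ) * t0 D) ≤ Real.log (Real.exp (520 * ell D)) :=
        Real.log_le_log (D_mul_t0_pos hD) (D_mul_t0_le_exp hD hL)
    _ = 520 * ell D := Real.log_exp _

/-- **`g̃₂(y) = g̃₁(yP^{0.004}/(Dt₀))`** (§11 p. 62; `D ≥ 2`): substitute `z ↦ z − 0.004` in the two
integrals of `g̃₁` (`P^z/(yP^{0.004}/(Dt₀)) = P^{z−0.004}Dt₀/y`). [Z22 p.62, tex L3202–L3207]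
[cite: Zhang2022LandauSiegel, §11 p. 62] -/
theorem gtilde2_eq_gtilde1_scaleJ2 (hD : 2 ≤ D) (y : ℝ) :
    gtilde2 D y = gtilde1 D (scaleJ2 D y) := by
  have hP0 : 0 < bigP D := Real.exp_pos _
  have hDt : 0 < (D : ℝ) * t0 D := D_mul_t0_pos hD
  have harg : ∀ z : ℝ, bigP D ^ z / scaleJ2 D y = bigP D ^ (z - 0.004) * D * t0 D / y := by
    intro z
    rw [scaleJ2, Real.rpow_sub hP0]
    field_simp
  rw [gtilde1, gtilde2]
  simp_rw [harg]
  have h1 : (∫ z in (0.5 : ℝ)..0.502, gW D (bigP D ^ (z - 0.004) * D * t0 D / y)) =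
      ∫ z in (0.496 : ℝ)..0.498, gW D (bigP D ^ z * D * t0 D / y) := by
    rw [intervalIntegral.integral_comp_sub_right (fun z => gW D (bigP D ^ z * D * t0 D / y))
      (0.004 : ℝ)]
    norm_num
  have h2 : (∫ z in (0.502 : ℝ)..0.504, gW D (bigP D ^ (z - 0.004) * D * t0 D / y)) =
      ∫ z in (0.498 : ℝ)..0.5, gW D (bigP D ^ z * D * t0 D / y) := by
    rw [intervalIntegral.integral_comp_sub_right (fun z => gW D (bigP D ^ z * D * t0 D / y))
      (0.004 : ℝ)]
    norm_num
  rw [h1, h2]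

/-- **The tent of `J₂` is the tent of `J₁` at the scaled point**: for `y > 0` (`D ≥ 2`),
`log y/log P + 0.004 − α̃ = log(yP^{0.004}/(Dt₀))/log P`. [Z22 p.10, (2.30)]
[cite: Zhang2022LandauSiegel, §2 (2.30)] -/
theorem tentArg_J2_eq (hD : 2 ≤ D) {y : ℝ} (hy : 0 < y) :
    Real.log y / Real.log (bigP D) + 0.004 - alphaTilde D =
      Real.log (scaleJ2 D y) / Real.log (bigP D) := by
  have hP0 : 0 < bigP D := Real.exp_pos _
  have hDt : 0 < (D : ℝ) * t0 D := D_mul_t0_pos hD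
  have hD' : (2 : ℝ) ≤ D := by exact_mod_cast hD
  have hℓ : 0 < ell D := Real.log_pos (by linarith)
  have hlogP : Real.log (bigP D) = ell D ^ 9 := by rw [bigP, Real.log_exp]
  have hlogP0 : Real.log (bigP D) ≠ 0 := by rw [hlogP]; positivity
  rw [scaleJ2, alphaTilde, Real.log_div (by positivity) hDt.ne', Real.log_mul hy.ne' (by positivity),
    Real.log_rpow hP0]
  field_simp

/-- **`J₂(s,ψ) = Σ_n χψ(n)n^{−s}f̃(log(nP^{0.004}/(Dt₀))/log P)`** (for `s ≠ 0`, `D ≥ 2`; the `n = 0`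
term vanishes on both sides). [Z22 p.10, (2.30)] [cite: Zhang2022LandauSiegel, §2 (2.30)] -/
theorem J2_eq_finsum_scaleJ2 [NeZero D] (χ : DirichletCharacter ℂ D) (hD : 2 ≤ D) (x : Chr D)
    {s : ℂ} (hs : s ≠ 0) :
    J2 χ x s = ∑ᶠ n : ℕ, pc χ x n * (n : ℂ) ^ (-s) *
      (ftilde (Real.log (scaleJ2 D n) / Real.log (bigP D)) : ℂ) := by
  rw [J2]
  refine finsum_congr fun n => ?_
  rcases Nat.eq_zero_or_pos n with rfl | hn
  · simp [Complex.zero_cpow (neg_ne_zero.mpr hs)]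
  · rw [tentArg_J2_eq hD (by exact_mod_cast hn)]

/-- `f̃(log y/log P) ≠ 0` forces `P^{0.5} ≤ y ≤ P^{0.504}` for a real `y > 0`.
[cite: Zhang2022LandauSiegel, §2 (2.28)] -/
private theorem ftilde_ne_zero_bounds_real (hL : 0 < ell D) {y : ℝ} (hy : 0 < y)
    (h : ftilde (Real.log y / Real.log (bigP D)) ≠ 0) :
    bigP D ^ (0.5 : ℝ) ≤ y ∧ y ≤ bigP D ^ (0.504 : ℝ) := by
  have hlogP : Real.log (bigP D) = ell D ^ 9 := by rw [bigP, Real.log_exp]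
  have hlogP0 : 0 < Real.log (bigP D) := by rw [hlogP]; positivity
  have hP0 : 0 < bigP D := Real.exp_pos _
  have hz : 0.5 ≤ Real.log y / Real.log (bigP D) ∧ Real.log y / Real.log (bigP D) ≤ 0.504 := by
    unfold ftilde at h
    split_ifs at h with h1 h2
    · exact ⟨h1.1, by linarith [h1.2]⟩
    · exact ⟨by linarith [h2.1], h2.2⟩
    · exact absurd rfl h
  constructor
  · have h05 := hz.1
    rw [le_div_iff₀ hlogP0] at h05
    calc bigP D ^ (0.5 : ℝ) = Real.exp (Real.log (bigP D) * 0.5) := Real.rpow_def_of_pos hP0 _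
      _ ≤ Real.exp (Real.log y) := Real.exp_le_exp.mpr (by linarith)
      _ = y := Real.exp_log hy
  · have h504 := hz.2
    rw [div_le_iff₀ hlogP0] at h504
    calc y = Real.exp (Real.log y) := (Real.exp_log hy).symm
      _ ≤ Real.exp (Real.log (bigP D) * 0.504) := Real.exp_le_exp.mpr (by linarith)
      _ = bigP D ^ (0.504 : ℝ) := (Real.rpow_def_of_pos hP0 _).symm

/-- OBJECT (unprinted): the truncation point `N₂ = ⌈P₁η₊·Dt₀/P^{0.004}⌉` for the `J₂`-sums — every
`n` with `nP^{0.004}/(Dt₀) < P₁η₊` has `n ≤ N₂`. [Z22 p.64, tex L3306 ("Similarly")]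
[cite: Zhang2022LandauSiegel, §11 p. 64] -/
def N2 (D : ℕ) : ℕ := ⌈Skeleton.P1 D * etaPM D 1 * ((D : ℝ) * t0 D) / bigP D ^ (0.004 : ℝ)⌉₊

open scoped Classical in
/-- OBJECT (unprinted, asserted by "Similarly" p. 64): **`𝔍₂ ∩ ℕ`** — the integers `n` with
`nP^{0.004}/(Dt₀) ∈ 𝔍₁`, i.e. the three windows `(P^aη₋Dt₀P^{−0.004}, P^aη₊Dt₀P^{−0.004})`,
`a ∈ {0.5, 0.502, 0.504}` (= windows at `P^{0.496}Dt₀, P^{0.498}Dt₀, P^{0.5}Dt₀`), where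
`f̃(log n/log P + 0.004 − α̃) − g̃₂(n)` is only `≪ 𝓛⁻¹⁰`. [Z22 p.64, tex L3306]
[cite: Zhang2022LandauSiegel, §11 p. 64] -/
def frakI2Nat (D : ℕ) : Finset ℕ :=
  (Finset.Icc 1 (N2 D)).filter fun n : ℕ => scaleJ2 D n ∈ frakI1 D

/-- Outside the `J₂`-tails one has `1 ≤ n ≤ N₂` (`D ≥ 2`). [folklore] -/
private theorem mem_Icc_of_not_tail₂ (hD : 2 ≤ D) {n : ℕ}
    (h : ¬(scaleJ2 D n ≤ bigP D ^ (0.5 : ℝ) * etaPM D (-1) ∨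
      bigP D ^ (0.504 : ℝ) * etaPM D 1 ≤ scaleJ2 D n)) :
    n ∈ Finset.Icc 1 (N2 D) := by
  push Not at h
  have ha : 0 < bigP D ^ (0.5 : ℝ) * etaPM D (-1) :=
    mul_pos (Real.rpow_pos_of_pos (Real.exp_pos _) _) (Real.exp_pos _)
  have hDt : 0 < (D : ℝ) * t0 D := D_mul_t0_pos hD
  have hP4 : 0 < bigP D ^ (0.004 : ℝ) := Real.rpow_pos_of_pos (Real.exp_pos _) _
  rw [Finset.mem_Icc]
  constructor
  · have hpos : 0 < scaleJ2 D n := ha.trans h.1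
    have : (0 : ℝ) < n := by
      by_contra hc
      push Not at hc
      have : scaleJ2 D n ≤ 0 := by
        rw [scaleJ2]
        exact div_nonpos_of_nonpos_of_nonneg (mul_nonpos_of_nonpos_of_nonneg hc hP4.le) hDt.le
      linarith
    exact Nat.one_le_iff_ne_zero.mpr (by rintro rfl; simp at this)
  · have hlt : (n : ℝ) < Skeleton.P1 D * etaPM D 1 * ((D : ℝ) * t0 D) / bigP D ^ (0.004 : ℝ) := by
      rw [lt_div_iff₀ hP4]
      have := h.2
      rw [scaleJ2, div_lt_iff₀ hDt] at this
      simpa [Skeleton.P1] using this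
    rw [N2]
    exact_mod_cast (hlt.le.trans (Nat.le_ceil _))

/-- Membership in `𝔍₂ ∩ ℕ` is membership of the scaled point `nP^{0.004}/(Dt₀)` in `𝔍₁` (`D ≥ 2`;
the truncation at `N₂` is automatic). [Z22 p.64, tex L3295, L3306] [cite: Zhang2022LandauSiegel, §11 p. 64] -/
theorem mem_frakI2Nat_iff (hD : 2 ≤ D) (n : ℕ) : n ∈ frakI2Nat D ↔ scaleJ2 D n ∈ frakI1 D := by
  classical
  have hL : 0 < ell D := Real.log_pos (by exact_mod_cast (by omega : 1 < D))
  rw [frakI2Nat, Finset.mem_filter]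
  exact ⟨fun h => h.2, fun h => ⟨mem_Icc_of_not_tail₂ hD (not_tail_of_mem_frakI1 hL h), h⟩⟩

/-- `N₂ ≤ 2e^{0.504𝓛⁹ + 520𝓛 + 1}` for `𝓛 ≥ 1`, `D ≥ 2` (`D = e^𝓛`, `t₀ = 𝓛⁵¹⁹ ≤ e^{519𝓛}`,
`P^{0.004} ≥ 1`). [folklore] -/
private theorem N2_le (hD : 2 ≤ D) (hL : 1 ≤ ell D) :
    ((N2 D : ℕ) : ℝ) ≤ 2 * Real.exp (0.504 * ell D ^ 9 + 520 * ell D + 1) := by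
  have hP0 : 0 < bigP D := Real.exp_pos _
  have hDt : 0 < (D : ℝ) * t0 D := D_mul_t0_pos hD
  have hP4 : 1 ≤ bigP D ^ (0.004 : ℝ) := Real.one_le_rpow (Real.one_le_exp (by positivity)) (by norm_num)
  have hP1eq : Skeleton.P1 D = Real.exp (0.504 * ell D ^ 9) := by
    rw [Skeleton.P1, bigP, Real.rpow_def_of_pos (Real.exp_pos _), Real.log_exp, mul_comm]
  have heta : etaPM D 1 ≤ Real.exp 1 := by
    rw [etaPM, one_mul]
    exact Real.exp_le_exp.mpr (inv_le_one_of_one_le₀ (one_le_pow₀ hL))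
  have hDt' : (D : ℝ) * t0 D ≤ Real.exp (520 * ell D) := D_mul_t0_le_exp hD hL
  have heta0 : 0 < etaPM D 1 := Real.exp_pos _
  have hP10 : 0 < Skeleton.P1 D := Real.rpow_pos_of_pos hP0 _
  have hb0 : 0 ≤ Skeleton.P1 D * etaPM D 1 * ((D : ℝ) * t0 D) / bigP D ^ (0.004 : ℝ) := by
    positivity
  have hmain : Skeleton.P1 D * etaPM D 1 * ((D : ℝ) * t0 D) / bigP D ^ (0.004 : ℝ) ≤
      Real.exp (0.504 * ell D ^ 9 + 520 * ell D + 1) := by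
    calc Skeleton.P1 D * etaPM D 1 * ((D : ℝ) * t0 D) / bigP D ^ (0.004 : ℝ)
        ≤ Skeleton.P1 D * etaPM D 1 * ((D : ℝ) * t0 D) := div_le_self (by positivity) hP4
      _ ≤ Real.exp (0.504 * ell D ^ 9) * Real.exp 1 * Real.exp (520 * ell D) := by
          rw [hP1eq]
          gcongr
      _ = Real.exp (0.504 * ell D ^ 9 + 520 * ell D + 1) := by
          rw [← Real.exp_add, ← Real.exp_add]; ring_nf
  have h1 : 1 ≤ Real.exp (0.504 * ell D ^ 9 + 520 * ell D + 1) := Real.one_le_exp (by positivity)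
  calc ((N2 D : ℕ) : ℝ) ≤ Skeleton.P1 D * etaPM D 1 * ((D : ℝ) * t0 D) / bigP D ^ (0.004 : ℝ) + 1 := by
        rw [N2]; exact (Nat.ceil_lt_add_one hb0).le
    _ ≤ 2 * Real.exp (0.504 * ell D ^ 9 + 520 * ell D + 1) := by linarith

section J2Objects

variable [NeZero D] (χ : DirichletCharacter ℂ D) (x : Chr D)

/-- OBJECT (unprinted; the `J₂`-analogue of the sum in (11.5)):
**`Σ_{n∈𝔍₂} χψ(n)n^{−s}(f̃(log n/log P + 0.004 − α̃) − g̃₂(n))`**. [Z22 p.64, tex L3306]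
[cite: Zhang2022LandauSiegel, §11 p. 64] -/
def frakI2Sum (s : ℂ) : ℂ :=
  ∑ n ∈ frakI2Nat D, pc χ x n * (n : ℂ) ^ (-s) *
    ((ftilde (Real.log n / Real.log (bigP D) + 0.004 - alphaTilde D) : ℂ) - (gtilde2 D n : ℂ))

end J2Objects

variable (c' : ℝ)

/-- `Z22:§11.u021` input, CLAIM (UNPRINTED — asserted by "Similarly", p. 64 tex L3306): the
`J₂`-analogue of (11.5), **`J₂(s,ψ) − J̃₂(s,ψ) = Σ_{n∈𝔍₂} χψ(n)n^{−s}(f̃(log n/log P + 0.004 − α̃) −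
g̃₂(n)) + O(ε)`** for `σ = 1/2` (`J₂ = Skeleton.J2`, `J̃₂(s,ψ) = Σ_nχψ(n)g̃₂(n)n^{−s}` written out,
`g̃₂ = Skeleton.gtilde2`; `ε = exp{−c𝓛¹⁰}`). PROVED from Lemma 11.1 and `TailsJ2` in `eq115J2_of`.
[Z22 p.64, tex L3306] [cite: Zhang2022LandauSiegel, §11 p. 64] -/
def Eq115J2 : Prop :=
  ∃ c : ℝ, 0 < c ∧ ∃ C : ℝ, ForAllLarge fun D _ χ => AssumptionA D χ → ∀ x : Chr D, ∀ s : ℂ,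
    s.re = 1 / 2 →
      ‖(J2 χ x s - ∑' n : ℕ, pc χ x n * (gtilde2 D n : ℂ) * (n : ℂ) ^ (-s)) - frakI2Sum χ x s‖
        ≤ C * Real.exp (-c * ell D ^ 10)

/-- `Z22:§11.u021` input, CLAIM (UNPRINTED — asserted by "Similarly", p. 64; the `J₂`-analogue of the
tails sentence of p. 63, tex L3216): **for `σ = 1/2` the terms of `J̃₂(s,ψ)` with
`nP^{0.004}/(Dt₀) ≤ P^{0.5}η₋` or `nP^{0.004}/(Dt₀) ≥ P^{0.504}η₊` (i.e. `n ≤ P^{0.496}Dt₀η₋` or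
`n ≥ P^{0.5}Dt₀η₊`) contribute `≪ ε`.** [Z22 p.64, tex L3306; p.63 tex L3216]
[cite: Zhang2022LandauSiegel, §11 pp. 63–64] -/
def TailsJ2 : Prop :=
  ∃ c : ℝ, 0 < c ∧ ∃ C : ℝ, ForAllLarge fun D _ χ => AssumptionA D χ → ∀ x : Chr D, ∀ s : ℂ,
    s.re = 1 / 2 →
      ‖∑' n : ℕ, (if scaleJ2 D n ≤ bigP D ^ (0.5 : ℝ) * etaPM D (-1) ∨
            bigP D ^ (0.504 : ℝ) * etaPM D 1 ≤ scaleJ2 D n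
          then pc χ x n * (gtilde2 D n : ℂ) * (n : ℂ) ^ (-s) else 0)‖
        ≤ C * Real.exp (-c * ell D ^ 10)

/-- `Z22:§11.u021` input, CLAIM (UNPRINTED — asserted by "Similarly", p. 64; the `J₂`-analogue of
`Step11u019`, hence resting on the same non-existent "(8.25), (8.26)" — cell GAP row G-L3t10-1):
**`Σ_{ψ∈Ψ₁}Σ_{ρ} 𝔠*(ρ,ψ)|Σ_{n∈𝔍₂} χψ(n)n^{−ρ}(f̃(log n/log P + 0.004 − α̃) − g̃₂(n))|²ω(ρ) = o(𝔞𝔓)`.**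
[Z22 p.64, tex L3306] [cite: Zhang2022LandauSiegel, §11 p. 64] -/
def Step11u019J2 : Prop :=
  ∀ ε : ℝ, 0 < ε → ForAllLarge fun D _ χ => AssumptionA D χ →
    ∑ i ∈ idx χ, (cstar c' D i.1 i.2).re * ‖frakI2Sum χ i.1 i.2‖ ^ 2 * (omegaW D i.2).re
      ≤ ε * frakA χ * frakP D

/-- `Z22:Prop2.6.pf` (part) CLAIM: the deduction hidden in "Similarly" (p. 64) — `Step11u021` from its
unprinted inputs `Eq115J2`, `Step11u019J2`, exactly as `DedStep11u020` obtains `Step11u020` from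
(11.5) and `Step11u019` (same silent §2/§7/§8 inputs: Lemma 2.3, Prop. 2.2 (i), the total-mass bound
via Lemma 8.1/Prop. 7.1, `𝔞 ≫ 1`). [Z22 p.64, tex L3306] [cite: Zhang2022LandauSiegel, §11 p. 64] -/
def DedStep11u021 : Prop :=
  Lemma23 c' → Prop22i → Lemma81 c' → Prop71 c' → FrakALowerBound → Eq115J2 → Step11u019J2 c' →
    Step11u021 c'

/-! ### The `J₂`-tails hold (from (4.2)/(4.3) via `Section11GaussTails`) -/

/-- **Head** (real `y`): for `0 < y ≤ P^{0.5}η₋`, `|g̃₁(y)| ≤ e^{−𝓛¹⁰}` — both integrals of `g̃₁`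
are `0.002(1 + O(e^{−𝓛¹⁰}))` by (4.2) (`GaussTails.abs_integral_gW_sub_len_le`) and the weights `∓500`
cancel (sz-d32's `abs_weight_le_head`, there for `y ≥ 1`; the scaled points `Yₙ` may be `< 1`).
[Z22 p.63, tex L3216; §4 (4.2)] [cite: Zhang2022LandauSiegel, §11 p. 63] -/
theorem abs_gtilde1_le_of_le_head (hL : 0 < ell D) {y : ℝ} (hy0 : 0 < y)
    (hy : y ≤ bigP D ^ (0.5 : ℝ) * etaPM D (-1)) : |gtilde1 D y| ≤ Real.exp (-ell D ^ 10) := by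
  have h9 : 0 < ell D ^ 9 := pow_pos hL 9
  have hlogy : Real.log y ≤ 0.5 * ell D ^ 9 - (ell D ^ 10)⁻¹ := by
    have h1 := Real.log_le_log hy0 hy
    rw [GaussTails.log_rpow_mul_etaPM] at h1
    linarith
  have h1 := GaussTails.abs_integral_gW_sub_len_le hL hy0 (a := 0.5) (b := 0.502) (by norm_num)
    (by linarith)
  have h2 := GaussTails.abs_integral_gW_sub_len_le hL hy0 (a := 0.502) (b := 0.504) (by norm_num)
    (by linarith)
  rw [gtilde1]
  rw [abs_le] at h1 h2 ⊢
  obtain ⟨h1l, h1u⟩ := h1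
  obtain ⟨h2l, h2u⟩ := h2
  set I₁ : ℝ := ∫ z in (0.5 : ℝ)..0.502, gW D (bigP D ^ z / y) with hI₁
  set I₂ : ℝ := ∫ z in (0.502 : ℝ)..0.504, gW D (bigP D ^ z / y) with hI₂
  set ε : ℝ := Real.exp (-ell D ^ 10) with hε
  norm_num at h1l h1u h2l h2u ⊢
  constructor <;> linarith

/-- **Tail** (real `y`): for `y ≥ P^{0.504}η₊`, `|g̃₁(y)| ≤ e^{−𝓛²⁰(log y − 0.504𝓛⁹)}` — on both
ranges of integration `0 ≤ g(P^z/y) ≤ ½e^{−𝓛²⁰u}` by (4.3) (`GaussTails.abs_integral_gW_le`; sz-d32's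
`abs_weight_le_tail`, read on the banked `g̃₁`). [Z22 p.63, tex L3216; §4 (4.3)]
[cite: Zhang2022LandauSiegel, §11 p. 63] -/
theorem abs_gtilde1_le_of_tail_le (hL : 0 < ell D) {y : ℝ}
    (hy : bigP D ^ (0.504 : ℝ) * etaPM D 1 ≤ y) :
    |gtilde1 D y| ≤ Real.exp (-(ell D ^ 20 * (Real.log y - 0.504 * ell D ^ 9))) := by
  have h9 : 0 < ell D ^ 9 := pow_pos hL 9
  have hy0 : 0 < y := lt_of_lt_of_le (GaussTails.rpow_mul_etaPM_pos D _ _) hy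
  have hlogy : 0.504 * ell D ^ 9 + (ell D ^ 10)⁻¹ ≤ Real.log y := by
    have h1 := Real.log_le_log (GaussTails.rpow_mul_etaPM_pos D _ _) hy
    rw [GaussTails.log_rpow_mul_etaPM] at h1
    linarith
  set u : ℝ := Real.log y - 0.504 * ell D ^ 9 with hu_def
  have hu : (ell D ^ 10)⁻¹ ≤ u := by rw [hu_def]; linarith
  have h1 := GaussTails.abs_integral_gW_le hL hy0 (a := 0.5) (b := 0.502) (by norm_num) hu
    (by rw [hu_def]; linarith)
  have h2 := GaussTails.abs_integral_gW_le hL hy0 (a := 0.502) (b := 0.504) (by norm_num) hu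
    (by rw [hu_def]; linarith)
  rw [gtilde1]
  rw [abs_le] at h1 h2 ⊢
  obtain ⟨h1l, h1u⟩ := h1
  obtain ⟨h2l, h2u⟩ := h2
  set I₁ : ℝ := ∫ z in (0.5 : ℝ)..0.502, gW D (bigP D ^ z / y) with hI₁
  set I₂ : ℝ := ∫ z in (0.502 : ℝ)..0.504, gW D (bigP D ^ z / y) with hI₂
  set ε : ℝ := Real.exp (-(ell D ^ 20 * u)) with hε
  norm_num at h1l h1u h2l h2u ⊢
  constructor <;> linarith

/-- **`TailsJ2` HOLDS** (`c = 1/2`, `C = 2`, `D ≥ max(⌈e⁵⌉, 9)`): the `J₂`-tails claim hidden in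
"Similarly" follows from (4.2)/(4.3) exactly as the `J̃₁`-tails (sz-d32, `Section11GaussTails`): with
`Yₙ = nP^{0.004}/(Dt₀)`, `log Yₙ = log n + 0.004𝓛⁹ − log(Dt₀)` and `log(Dt₀) ≤ 520𝓛`, the head
(`Yₙ ≤ P^{0.5}η₋`, so `log n ≤ 0.496𝓛⁹ + 520𝓛 ≤ 𝓛⁹`) has `|g̃₂(n)| ≤ e^{−𝓛¹⁰} ≤ e^{−𝓛¹⁰/2}n⁻²`, and the
tail (`Yₙ ≥ P^{0.504}η₊`, i.e. `log n ≥ a + 𝓛⁻¹⁰`, `a = 0.5𝓛⁹ + log(Dt₀) ≤ 𝓛⁹`) has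
`|g̃₂(n)| ≤ e^{−𝓛²⁰(log n − a)} ≤ e^{−𝓛¹⁰/2}n⁻²`; sum `≤ (π²/6)e^{−𝓛¹⁰/2} ≤ 2e^{−𝓛¹⁰/2}`.
[Z22 p.64, tex L3306; p.63 tex L3216] [cite: Zhang2022LandauSiegel, §11 pp. 63–64] -/
theorem tailsJ2_holds : TailsJ2 := by
  refine ⟨1 / 2, by norm_num, 2, max ⌈Real.exp 5⌉₊ 9, fun D _ χ hD _ _ _ x s hs => ?_⟩
  have hD5 : ⌈Real.exp 5⌉₊ ≤ D := le_trans (le_max_left _ _) hD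
  have hD9 : 9 ≤ D := le_trans (le_max_right _ _) hD
  have hD2 : 2 ≤ D := le_trans (by norm_num) hD9
  have hL5 : 5 ≤ ell D := GaussTails.five_le_ell hD5
  have hL : 0 < ell D := by linarith
  have h9 : 0 < ell D ^ 9 := pow_pos hL 9
  have hv : 0 < (ell D ^ 10)⁻¹ := inv_pos.mpr (pow_pos hL 10)
  have hL8 : (390625 : ℝ) ≤ ell D ^ 8 := by
    have : (5 : ℝ) ^ 8 ≤ ell D ^ 8 := pow_le_pow_left₀ (by norm_num) hL5 8
    norm_num at this
    exact this
  have hlogDt : Real.log ((D : ℝ) * t0 D) ≤ 520 * ell D := log_D_mul_t0_le hD2 (by linarith)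
  -- `520𝓛 ≤ 0.496·𝓛⁹` (amply, `𝓛 ≥ 5`)
  have h520 : 520 * ell D ≤ 0.496 * ell D ^ 9 := by
    have : ell D ^ 9 = ell D ^ 8 * ell D := by ring
    nlinarith
  have hMsum : HasSum (fun n : ℕ => Real.exp (-(ell D ^ 10 / 2)) * (1 / (n : ℝ) ^ 2))
      (Real.exp (-(ell D ^ 10 / 2)) * (π ^ 2 / 6)) := hasSum_zeta_two.mul_left _
  refine (GaussTails.norm_tsum_le_of_hasSum hMsum fun n => ?_).trans
    (GaussTails.zeta_two_mul_exp_le (ell D))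
  split_ifs with hcond
  · rcases Nat.eq_zero_or_pos n with rfl | hn
    · have hs0 : -s ≠ 0 := by
        intro h
        have := congrArg Complex.re h
        rw [Complex.neg_re, hs] at this
        norm_num at this
      simp [Complex.zero_cpow hs0]
    · have hn0 : (0 : ℝ) < n := by exact_mod_cast hn
      have hY0 : 0 < scaleJ2 D n := scaleJ2_pos hD2 hn0
      have hlogY : Real.log (scaleJ2 D n) =
          Real.log n + 0.004 * ell D ^ 9 - Real.log ((D : ℝ) * t0 D) := log_scaleJ2 hD2 hn0
      have hcpow : ‖(n : ℂ) ^ (-s)‖ ≤ 1 := norm_cpow_neg_le_one hn hs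
      have hg : |gtilde2 D n| ≤ Real.exp (-(ell D ^ 10 / 2)) * (1 / ((n : ℝ)) ^ 2) := by
        rw [gtilde2_eq_gtilde1_scaleJ2 hD2, mul_one_div, le_div_iff₀ (by positivity),
          GaussTails.natCast_sq_eq_exp hn]
        rcases hcond with hhead | htail
        · have h := abs_gtilde1_le_of_le_head hL hY0 hhead
          have hlog : Real.log n ≤ ell D ^ 9 := by
            have h1 := Real.log_le_log hY0 hhead
            rw [GaussTails.log_rpow_mul_etaPM, hlogY] at h1
            nlinarith
          calc |gtilde1 D (scaleJ2 D n)| * Real.exp (2 * Real.log n)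
              ≤ Real.exp (-ell D ^ 10) * Real.exp (2 * Real.log n) := by gcongr
            _ = Real.exp (-ell D ^ 10 + 2 * Real.log n) := (Real.exp_add _ _).symm
            _ ≤ Real.exp (-(ell D ^ 10 / 2)) :=
                Real.exp_le_exp.mpr (GaussTails.head_exponent_le hL5 le_rfl hlog)
        · have h := abs_gtilde1_le_of_tail_le hL htail
          have ha : 0.5 * ell D ^ 9 + Real.log ((D : ℝ) * t0 D) ≤ ell D ^ 9 := by nlinarith
          have hlog : 0.5 * ell D ^ 9 + Real.log ((D : ℝ) * t0 D) + (ell D ^ 10)⁻¹ ≤ Real.log n := by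
            have h1 := Real.log_le_log (GaussTails.rpow_mul_etaPM_pos D _ _) htail
            rw [GaussTails.log_rpow_mul_etaPM, hlogY] at h1
            linarith
          have hexp_eq : -(ell D ^ 20 * (Real.log (scaleJ2 D n) - 0.504 * ell D ^ 9)) =
              -(ell D ^ 20 * (Real.log n - (0.5 * ell D ^ 9 + Real.log ((D : ℝ) * t0 D)))) := by
            rw [hlogY]; ring
          calc |gtilde1 D (scaleJ2 D n)| * Real.exp (2 * Real.log n)
              ≤ Real.exp (-(ell D ^ 20 * (Real.log (scaleJ2 D n) - 0.504 * ell D ^ 9))) *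
                  Real.exp (2 * Real.log n) := by gcongr
            _ = Real.exp (-(ell D ^ 20 *
                  (Real.log n - (0.5 * ell D ^ 9 + Real.log ((D : ℝ) * t0 D)))) + 2 * Real.log n) := by
                rw [hexp_eq, Real.exp_add]
            _ ≤ Real.exp (-(ell D ^ 10 / 2)) :=
                Real.exp_le_exp.mpr (GaussTails.tail_exponent_le hL5 ha hlog)
      calc ‖pc χ x n * (gtilde2 D n : ℂ) * (n : ℂ) ^ (-s)‖
          = ‖pc χ x n‖ * |gtilde2 D n| * ‖(n : ℂ) ^ (-s)‖ := by
            rw [norm_mul, norm_mul, Complex.norm_real, Real.norm_eq_abs]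
        _ ≤ 1 * (Real.exp (-(ell D ^ 10 / 2)) * (1 / ((n : ℝ)) ^ 2)) * 1 := by
            gcongr
            exact norm_pc_le_one χ x n
        _ = Real.exp (-(ell D ^ 10 / 2)) * (1 / ((n : ℝ)) ^ 2) := by ring
  · simp only [norm_zero]
    positivity

/-- **The (11.5)-deduction at the scaled points, over an arbitrary weight `w` in place of `g̃₂`**
(the `J₂`-twin of `eq115_core`): if `f̃(log Y/log P) − w(y) = O(e^{−c𝓛¹⁰})` whenever
`Y = yP^{0.004}/(Dt₀)` lies in the closed ranges of (11.2), if the scaled tails of `Σ_nχψ(n)w(n)n^{−s}`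
are `O(e^{−c𝓛¹⁰})` and the series converges (`σ = 1/2`), then
`Σ_nχψ(n)n^{−s}f̃(log Yₙ/log P) − Σ_nχψ(n)w(n)n^{−s} = Σ_{n∈𝔍₂}χψ(n)n^{−s}(f̃(log Yₙ/log P) − w(n)) +
O(e^{−c'𝓛¹⁰})`: at most `N₂ ≤ 2e^{0.504𝓛⁹+520𝓛+1}` closed-range terms, each `O(e^{−c𝓛¹⁰})`, and
`0.504𝓛⁹ + 520𝓛 + 1 ≤ (c/2)𝓛¹⁰` once `𝓛 ≥ 6/c` (`𝓛 ≥ 2`). [Z22 p.64, tex L3306]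
[cite: Zhang2022LandauSiegel, §11 p. 64] -/
theorem eq115J2_core (w : ℕ → ℝ → ℝ)
    (h112 : ∃ c : ℝ, 0 < c ∧ ∃ C : ℝ, ForAllLarge fun D _ _ => ∀ y : ℝ,
      (bigP D ^ (0.5 : ℝ) * etaPM D 1 ≤ scaleJ2 D y ∧
          scaleJ2 D y ≤ bigP D ^ (0.502 : ℝ) * etaPM D (-1)) ∨
        (bigP D ^ (0.502 : ℝ) * etaPM D 1 ≤ scaleJ2 D y ∧
          scaleJ2 D y ≤ bigP D ^ (0.504 : ℝ) * etaPM D (-1)) →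
        |ftilde (Real.log (scaleJ2 D y) / Real.log (bigP D)) - w D y| ≤
          C * Real.exp (-c * ell D ^ 10))
    (htail : ∃ c : ℝ, 0 < c ∧ ∃ C : ℝ, ForAllLarge fun D _ χ => AssumptionA D χ → ∀ x : Chr D,
      ∀ s : ℂ, s.re = 1 / 2 →
        ‖∑' n : ℕ, (if scaleJ2 D n ≤ bigP D ^ (0.5 : ℝ) * etaPM D (-1) ∨
              bigP D ^ (0.504 : ℝ) * etaPM D 1 ≤ scaleJ2 D n
            then pc χ x n * (w D n : ℂ) * (n : ℂ) ^ (-s) else 0)‖ ≤ C * Real.exp (-c * ell D ^ 10))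
    (hsum : ForAllLarge fun D _ χ => ∀ x : Chr D, ∀ s : ℂ, s.re = 1 / 2 →
      Summable fun n : ℕ => pc χ x n * (w D n : ℂ) * (n : ℂ) ^ (-s)) :
    ∃ c : ℝ, 0 < c ∧ ∃ C : ℝ, ForAllLarge fun D _ χ => AssumptionA D χ → ∀ x : Chr D, ∀ s : ℂ,
      s.re = 1 / 2 →
        ‖((∑ᶠ n : ℕ, pc χ x n * (n : ℂ) ^ (-s) *
                (ftilde (Real.log (scaleJ2 D n) / Real.log (bigP D)) : ℂ)) -
              ∑' n : ℕ, pc χ x n * (w D n : ℂ) * (n : ℂ) ^ (-s)) -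
            ∑ n ∈ frakI2Nat D, pc χ x n * (n : ℂ) ^ (-s) *
              ((ftilde (Real.log (scaleJ2 D n) / Real.log (bigP D)) : ℂ) - (w D n : ℂ))‖
          ≤ C * Real.exp (-c * ell D ^ 10) := by
  classical
  obtain ⟨c₁, hc₁, C₁, h₁⟩ := h112
  obtain ⟨c₂, hc₂, C₂, h₂⟩ := htail
  have hc0 : 0 < min (c₁ / 2) c₂ := lt_min (by linarith) hc₂
  refine ⟨min (c₁ / 2) c₂, hc0, 2 * |C₁| + |C₂|, ?_⟩
  obtain ⟨D₀, h⟩ := (h₁.and h₂).and hsum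
  refine ⟨max D₀ (max 9 ⌈Real.exp (6 / c₁)⌉₊), fun D _ χ hD hq hp hA x s hs => ?_⟩
  have hD₀ : D₀ ≤ D := le_trans (le_max_left _ _) hD
  have hD9 : 9 ≤ D := le_trans (le_trans (le_max_left _ _) (le_max_right _ _)) hD
  have hD2 : 2 ≤ D := le_trans (by norm_num) hD9
  have hDc : ⌈Real.exp (6 / c₁)⌉₊ ≤ D := le_trans (le_trans (le_max_right _ _) (le_max_right _ _)) hD
  have hL2 : 2 ≤ ell D := two_le_ell hD9
  have hL1 : 1 ≤ ell D := by linarith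
  have hL0 : 0 < ell D := by linarith
  have hLc : 6 / c₁ ≤ ell D := by
    have hDpos : (0 : ℝ) < D := by exact_mod_cast lt_of_lt_of_le (by norm_num : 0 < 9) hD9
    have hexp : Real.exp (6 / c₁) ≤ D := le_trans (Nat.le_ceil _) (by exact_mod_cast hDc)
    exact (Real.le_log_iff_exp_le hDpos).mpr hexp
  have hs0 : s ≠ 0 := by
    intro h0; rw [h0, Complex.zero_re] at hs; norm_num at hs
  obtain ⟨⟨h₁', h₂'⟩, hsum'⟩ := h D χ hD₀ hq hp
  have hSum := hsum' x s hs
  have hTail := h₂' hA x s hs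
  -- the summands
  set f : ℕ → ℂ := fun n => pc χ x n * (w D n : ℂ) * (n : ℂ) ^ (-s) with hf
  set F : ℕ → ℂ := fun n =>
    pc χ x n * (n : ℂ) ^ (-s) * (ftilde (Real.log (scaleJ2 D n) / Real.log (bigP D)) : ℂ) with hF
  -- the finite set of non-tail indices
  set S : Finset ℕ := (Finset.Icc 1 (N2 D)).filter fun n : ℕ =>
    ¬(scaleJ2 D n ≤ bigP D ^ (0.5 : ℝ) * etaPM D (-1) ∨
      bigP D ^ (0.504 : ℝ) * etaPM D 1 ≤ scaleJ2 D n) with hSdef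
  have hmemS : ∀ n : ℕ, n ∈ S ↔
      ¬(scaleJ2 D n ≤ bigP D ^ (0.5 : ℝ) * etaPM D (-1) ∨
        bigP D ^ (0.504 : ℝ) * etaPM D 1 ≤ scaleJ2 D n) := by
    intro n
    rw [hSdef, Finset.mem_filter]
    exact ⟨fun h => h.2, fun h => ⟨mem_Icc_of_not_tail₂ hD2 h, h⟩⟩
  -- (i) the tent sum is the finite sum of `F` over `S`
  have hJ1 : (∑ᶠ n : ℕ, F n) = ∑ n ∈ S, F n := by
    apply finsum_eq_sum_of_support_subset
    intro n hn
    rw [Function.mem_support] at hn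
    rw [Finset.mem_coe, hmemS]
    have hn0 : 0 < n := by
      rcases Nat.eq_zero_or_pos n with rfl | hpos
      · exfalso; apply hn; rw [hF]
        simp [Complex.zero_cpow (neg_ne_zero.mpr hs0)]
      · exact hpos
    have hft : ftilde (Real.log (scaleJ2 D n) / Real.log (bigP D)) ≠ 0 := by
      intro h0
      apply hn
      rw [hF]
      simp only [h0, Complex.ofReal_zero, mul_zero]
    obtain ⟨hlo, hhi⟩ :=
      ftilde_ne_zero_bounds_real hL0 (scaleJ2_pos hD2 (by exact_mod_cast hn0)) hft
    have hm1 : etaPM D (-1) < 1 := by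
      rw [etaPM]; exact Real.exp_lt_one_iff.mpr (by
        have : (0:ℝ) < (ell D ^ 10)⁻¹ := by positivity
        linarith)
    have hp1 : 1 < etaPM D 1 := by
      rw [etaPM, one_mul]; exact Real.one_lt_exp_iff.mpr (by positivity)
    have hP5 : 0 < bigP D ^ (0.5 : ℝ) := Real.rpow_pos_of_pos (Real.exp_pos _) _
    have hP504 : 0 < bigP D ^ (0.504 : ℝ) := Real.rpow_pos_of_pos (Real.exp_pos _) _
    push Not
    constructor
    · calc bigP D ^ (0.5 : ℝ) * etaPM D (-1) < bigP D ^ (0.5 : ℝ) * 1 :=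
            mul_lt_mul_of_pos_left hm1 hP5
        _ = bigP D ^ (0.5 : ℝ) := mul_one _
        _ ≤ scaleJ2 D n := hlo
    · calc scaleJ2 D n ≤ bigP D ^ (0.504 : ℝ) := hhi
        _ = bigP D ^ (0.504 : ℝ) * 1 := (mul_one _).symm
        _ < bigP D ^ (0.504 : ℝ) * etaPM D 1 := mul_lt_mul_of_pos_left hp1 hP504
  -- (ii) the series splits into the sum over `S` and the tails
  have hJt : (∑' n : ℕ, f n) = (∑ n ∈ S, f n) +
      ∑' n : ℕ, (if scaleJ2 D n ≤ bigP D ^ (0.5 : ℝ) * etaPM D (-1) ∨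
          bigP D ^ (0.504 : ℝ) * etaPM D 1 ≤ scaleJ2 D n then f n else 0) := by
    rw [← hSum.sum_add_tsum_compl (s := S), tsum_subtype]
    congr 1
    refine tsum_congr fun n => ?_
    rw [Set.indicator_apply]
    have : n ∈ ((S : Set ℕ)ᶜ) ↔ (scaleJ2 D n ≤ bigP D ^ (0.5 : ℝ) * etaPM D (-1) ∨
        bigP D ^ (0.504 : ℝ) * etaPM D 1 ≤ scaleJ2 D n) := by
      rw [Set.mem_compl_iff, Finset.mem_coe, hmemS, not_not]
    by_cases hc : scaleJ2 D n ≤ bigP D ^ (0.5 : ℝ) * etaPM D (-1) ∨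
        bigP D ^ (0.504 : ℝ) * etaPM D 1 ≤ scaleJ2 D n
    · rw [if_pos (this.mpr hc), if_pos hc]
    · rw [if_neg (fun h => hc (this.mp h)), if_neg hc]
  -- (iii) `S` = windows ⊔ closed ranges
  have hW : S.filter (fun n : ℕ => scaleJ2 D n ∈ frakI1 D) = frakI2Nat D := by
    ext n
    rw [Finset.mem_filter, hmemS, mem_frakI2Nat_iff hD2]
    exact ⟨fun h => h.2, fun h => ⟨not_tail_of_mem_frakI1 hL0 h, h⟩⟩
  have hsplit : ∀ g : ℕ → ℂ, ∑ n ∈ S, g n =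
      (∑ n ∈ frakI2Nat D, g n) + ∑ n ∈ S.filter (fun n : ℕ => scaleJ2 D n ∉ frakI1 D), g n := by
    intro g
    rw [← hW, Finset.sum_filter_add_sum_filter_not]
  -- (iv) the closed-range terms are each `O(ε)`
  have hR : ∀ n ∈ S.filter (fun n : ℕ => scaleJ2 D n ∉ frakI1 D),
      ‖F n - f n‖ ≤ C₁ * Real.exp (-c₁ * ell D ^ 10) := by
    intro n hn
    rw [Finset.mem_filter, hmemS] at hn
    have hrange := range112_of_not_tail_not_mem hn.1 hn.2
    have hb := h₁' (n : ℝ) hrange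
    have hn1 : 0 < n := (Finset.mem_Icc.mp (mem_Icc_of_not_tail₂ hD2 hn.1)).1
    have e : F n - f n = pc χ x n * (n : ℂ) ^ (-s) *
        ((ftilde (Real.log (scaleJ2 D n) / Real.log (bigP D)) - w D n : ℝ) : ℂ) := by
      rw [hF, hf]; push_cast; ring
    rw [e, norm_mul, norm_mul, Complex.norm_real, Real.norm_eq_abs]
    calc ‖pc χ x n‖ * ‖(n : ℂ) ^ (-s)‖ *
          |ftilde (Real.log (scaleJ2 D n) / Real.log (bigP D)) - w D n|
        ≤ 1 * 1 * (C₁ * Real.exp (-c₁ * ell D ^ 10)) :=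
          mul_le_mul (mul_le_mul (norm_pc_le_one χ x n) (norm_cpow_neg_le_one hn1 hs)
            (norm_nonneg _) zero_le_one) hb (abs_nonneg _) (by norm_num)
      _ = C₁ * Real.exp (-c₁ * ell D ^ 10) := by ring
  -- (v) assemble
  have halg : ((∑ᶠ n : ℕ, F n) - ∑' n : ℕ, f n) -
      ∑ n ∈ frakI2Nat D, pc χ x n * (n : ℂ) ^ (-s) *
        ((ftilde (Real.log (scaleJ2 D n) / Real.log (bigP D)) : ℂ) - (w D n : ℂ)) =
      (∑ n ∈ S.filter (fun n : ℕ => scaleJ2 D n ∉ frakI1 D), (F n - f n)) -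
        ∑' n : ℕ, (if scaleJ2 D n ≤ bigP D ^ (0.5 : ℝ) * etaPM D (-1) ∨
          bigP D ^ (0.504 : ℝ) * etaPM D 1 ≤ scaleJ2 D n then f n else 0) := by
    have hWin : ∑ n ∈ frakI2Nat D, pc χ x n * (n : ℂ) ^ (-s) *
        ((ftilde (Real.log (scaleJ2 D n) / Real.log (bigP D)) : ℂ) - (w D n : ℂ)) =
        ∑ n ∈ frakI2Nat D, (F n - f n) := by
      refine Finset.sum_congr rfl fun n _ => ?_
      rw [hF, hf]; ring
    rw [hJ1, hJt, hsplit F, hsplit f, hWin, Finset.sum_sub_distrib, Finset.sum_sub_distrib]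
    ring
  have hNR : ((S.filter (fun n : ℕ => scaleJ2 D n ∉ frakI1 D)).card : ℝ) ≤
      2 * Real.exp (0.504 * ell D ^ 9 + 520 * ell D + 1) := by
    calc ((S.filter (fun n : ℕ => scaleJ2 D n ∉ frakI1 D)).card : ℝ)
        ≤ (Finset.Icc 1 (N2 D)).card := by
          have hsub : S.filter (fun n : ℕ => scaleJ2 D n ∉ frakI1 D) ⊆ Finset.Icc 1 (N2 D) :=
            (Finset.filter_subset _ S).trans (by rw [hSdef]; exact Finset.filter_subset _ _)
          exact_mod_cast Finset.card_le_card hsub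
      _ = N2 D := by simp
      _ ≤ 2 * Real.exp (0.504 * ell D ^ 9 + 520 * ell D + 1) := N2_le hD2 hL1
  have hsumR : ‖∑ n ∈ S.filter (fun n : ℕ => scaleJ2 D n ∉ frakI1 D), (F n - f n)‖ ≤
      2 * Real.exp (0.504 * ell D ^ 9 + 520 * ell D + 1) * (|C₁| * Real.exp (-c₁ * ell D ^ 10)) := by
    have hC : C₁ * Real.exp (-c₁ * ell D ^ 10) ≤ |C₁| * Real.exp (-c₁ * ell D ^ 10) :=
      mul_le_mul_of_nonneg_right (le_abs_self _) (Real.exp_pos _).le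
    calc ‖∑ n ∈ S.filter (fun n : ℕ => scaleJ2 D n ∉ frakI1 D), (F n - f n)‖
        ≤ ∑ n ∈ S.filter (fun n : ℕ => scaleJ2 D n ∉ frakI1 D), ‖F n - f n‖ := norm_sum_le _ _
      _ ≤ ∑ n ∈ S.filter (fun n : ℕ => scaleJ2 D n ∉ frakI1 D), |C₁| * Real.exp (-c₁ * ell D ^ 10) :=
          Finset.sum_le_sum fun n hn => (hR n hn).trans hC
      _ = ((S.filter (fun n : ℕ => scaleJ2 D n ∉ frakI1 D)).card : ℝ) *
            (|C₁| * Real.exp (-c₁ * ell D ^ 10)) := by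
          rw [Finset.sum_const, nsmul_eq_mul]
      _ ≤ 2 * Real.exp (0.504 * ell D ^ 9 + 520 * ell D + 1) * (|C₁| * Real.exp (-c₁ * ell D ^ 10)) :=
          mul_le_mul_of_nonneg_right hNR (by positivity)
  -- exponent bookkeeping
  have hE1 : Real.exp (0.504 * ell D ^ 9 + 520 * ell D + 1) * Real.exp (-c₁ * ell D ^ 10) ≤
      Real.exp (-(min (c₁ / 2) c₂) * ell D ^ 10) := by
    rw [← Real.exp_add]
    apply Real.exp_le_exp.mpr
    have hmin : min (c₁ / 2) c₂ ≤ c₁ / 2 := min_le_left _ _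
    have h9 : 0 ≤ ell D ^ 9 := by positivity
    have hcL : 6 ≤ c₁ * ell D := by
      have := mul_le_mul_of_nonneg_left hLc hc₁.le
      rwa [mul_div_cancel₀ _ hc₁.ne'] at this
    -- 520 L + 1 ≤ 521 L ≤ 521 L^9 / 256 ≤ 2.1 L^9 (L ≥ 2); 0.504 L^9 + 2.1 L^9 ≤ 3 L^9 ≤ (c₁/2) L^10
    have hL8 : (256 : ℝ) ≤ ell D ^ 8 := by
      calc (256 : ℝ) = 2 ^ 8 := by norm_num
        _ ≤ ell D ^ 8 := pow_le_pow_left₀ (by norm_num) hL2 8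
    have hLin : 520 * ell D + 1 ≤ 521 * ell D := by linarith
    have h9L : ell D ^ 9 = ell D ^ 8 * ell D := by ring
    have h10L : ell D ^ 10 = ell D ^ 9 * ell D := by ring
    nlinarith [mul_le_mul_of_nonneg_left hmin (by positivity : (0:ℝ) ≤ ell D ^ 10),
      mul_le_mul_of_nonneg_right hL8 hL0.le]
  have hE2 : Real.exp (-c₂ * ell D ^ 10) ≤ Real.exp (-(min (c₁ / 2) c₂) * ell D ^ 10) := by
    apply Real.exp_le_exp.mpr
    have hmin : min (c₁ / 2) c₂ ≤ c₂ := min_le_right _ _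
    nlinarith [mul_le_mul_of_nonneg_left hmin (by positivity : (0:ℝ) ≤ ell D ^ 10)]
  rw [halg]
  calc ‖(∑ n ∈ S.filter (fun n : ℕ => scaleJ2 D n ∉ frakI1 D), (F n - f n)) -
          ∑' n : ℕ, (if scaleJ2 D n ≤ bigP D ^ (0.5 : ℝ) * etaPM D (-1) ∨
            bigP D ^ (0.504 : ℝ) * etaPM D 1 ≤ scaleJ2 D n then f n else 0)‖
      ≤ ‖∑ n ∈ S.filter (fun n : ℕ => scaleJ2 D n ∉ frakI1 D), (F n - f n)‖ +
          ‖∑' n : ℕ, (if scaleJ2 D n ≤ bigP D ^ (0.5 : ℝ) * etaPM D (-1) ∨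
            bigP D ^ (0.504 : ℝ) * etaPM D 1 ≤ scaleJ2 D n then f n else 0)‖ := norm_sub_le _ _
    _ ≤ 2 * Real.exp (0.504 * ell D ^ 9 + 520 * ell D + 1) * (|C₁| * Real.exp (-c₁ * ell D ^ 10)) +
          |C₂| * Real.exp (-c₂ * ell D ^ 10) :=
        add_le_add hsumR
          (hTail.trans (mul_le_mul_of_nonneg_right (le_abs_self _) (Real.exp_pos _).le))
    _ = 2 * |C₁| * (Real.exp (0.504 * ell D ^ 9 + 520 * ell D + 1) * Real.exp (-c₁ * ell D ^ 10)) +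
          |C₂| * Real.exp (-c₂ * ell D ^ 10) := by ring
    _ ≤ 2 * |C₁| * Real.exp (-(min (c₁ / 2) c₂) * ell D ^ 10) +
          |C₂| * Real.exp (-(min (c₁ / 2) c₂) * ell D ^ 10) :=
        add_le_add (mul_le_mul_of_nonneg_left hE1 (by positivity))
          (mul_le_mul_of_nonneg_left hE2 (abs_nonneg _))
    _ = (2 * |C₁| + |C₂|) * Real.exp (-(min (c₁ / 2) c₂) * ell D ^ 10) := by ring

/-- **The series of `J̃₂(s,ψ)` converges for `σ = 1/2`** (`D ≥ 9`): `g̃₂(n) = g̃₁(Yₙ)` and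
`Yₙ ≥ P^{0.504}` for `n ≥ P^{0.5}Dt₀`, where (4.3) gives `|g̃₁(Yₙ)| ≤ (P^{0.504}/Yₙ)² ≤ (P^{0.5}Dt₀/n)²`.
[Z22 p.63, tex L3209; §4 (4.3)] [cite: Zhang2022LandauSiegel, §11 p. 63] -/
theorem summable_Jtilde2 [NeZero D] (χ : DirichletCharacter ℂ D) (hD : 9 ≤ D) (x : Chr D)
    {s : ℂ} (hs : s.re = 1 / 2) :
    Summable fun n : ℕ => pc χ x n * (gtilde2 D n : ℂ) * (n : ℂ) ^ (-s) := by
  have hD2 : 2 ≤ D := le_trans (by norm_num) hD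
  have hL2 : 2 ≤ ell D := two_le_ell hD
  have hL0 : 0 < ell D := by linarith
  have hΛ : 0 < ell D ^ 30 := by positivity
  have hΛ2 : (2 : ℝ) ≤ ell D ^ 30 :=
    le_trans (by norm_num) (pow_le_pow_left₀ (by norm_num) hL2 30)
  have hP0 : 0 < bigP D := Real.exp_pos _
  have hDt : 0 < (D : ℝ) * t0 D := D_mul_t0_pos hD2
  have hP4 : 0 < bigP D ^ (0.004 : ℝ) := Real.rpow_pos_of_pos hP0 _
  -- `R = P^{0.5}Dt₀`: for `n ≥ R`, `Yₙ ≥ P^{0.504}` and `P^{0.504}/Yₙ = R/n`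
  set Q : ℝ := bigP D ^ (0.504 : ℝ) with hQ
  have hQ0 : 0 < Q := Real.rpow_pos_of_pos hP0 _
  set R : ℝ := bigP D ^ (0.5 : ℝ) * ((D : ℝ) * t0 D) with hR
  have hR0 : 0 < R := mul_pos (Real.rpow_pos_of_pos hP0 _) hDt
  have hscale : ∀ y : ℝ, scaleJ2 D y = y * Q / R := by
    intro y
    rw [scaleJ2, hQ, hR, show (0.504 : ℝ) = 0.004 + 0.5 by norm_num, Real.rpow_add hP0]
    field_simp
  refine Summable.of_norm_bounded_eventually_nat
    ((Real.summable_one_div_nat_pow.mpr one_lt_two).mul_left (R ^ 2)) ?_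
  rw [Filter.eventually_atTop]
  refine ⟨⌈Real.exp 1 * R⌉₊ + 1, fun n hn => ?_⟩
  have hn0 : 0 < n := by omega
  have hn0' : (0 : ℝ) < n := by exact_mod_cast hn0
  have hnR : Real.exp 1 * R ≤ n := by
    have h1 := Nat.le_ceil (Real.exp 1 * R)
    have h2 : ((⌈Real.exp 1 * R⌉₊ + 1 : ℕ) : ℝ) ≤ n := by exact_mod_cast hn
    push_cast at h2
    linarith
  have he1 : 1 ≤ Real.exp 1 := Real.one_le_exp zero_le_one
  have hRn : R ≤ n := le_trans (by nlinarith) hnR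
  set Y : ℝ := scaleJ2 D n with hY
  have hYeq : Y = n * Q / R := hscale n
  have hY0 : 0 < Y := by rw [hYeq]; positivity
  have hQY : Q ≤ Y := by
    rw [hYeq, le_div_iff₀ hR0]
    nlinarith
  have hQYeq : Q / Y = R / n := by
    rw [hYeq]; field_simp
  have hu : 1 ≤ Real.log (Y / Q) := by
    rw [Real.le_log_iff_exp_le (div_pos hY0 hQ0), le_div_iff₀ hQ0, hYeq, le_div_iff₀ hR0]
    nlinarith
  have hw := abs_printedWeight_le hL0 hQY
  have hgQY : 0 < gW D (Q / Y) := GaussWeight.gWeight_pos hΛ _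
  have hG : gW D (Q / Y) ≤ 1 / 2 * Real.exp (-(ell D ^ 30) * (Real.log (Q / Y)) ^ 2) :=
    GaussWeight.gWeight_le hΛ (div_pos hQ0 hY0) ((div_le_one hY0).mpr hQY)
  have hlog : Real.log (Q / Y) = -Real.log (Y / Q) := by
    rw [Real.log_div hQ0.ne' hY0.ne', Real.log_div hY0.ne' hQ0.ne']; ring
  have hexp : Real.exp (-(ell D ^ 30) * (Real.log (Q / Y)) ^ 2) ≤ (Q / Y) ^ 2 := by
    rw [hlog, neg_sq]
    have hu0 : 0 ≤ Real.log (Y / Q) := by linarith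
    have h1 : -(ell D ^ 30) * Real.log (Y / Q) ^ 2 ≤ -2 * Real.log (Y / Q) := by nlinarith
    calc Real.exp (-(ell D ^ 30) * Real.log (Y / Q) ^ 2)
        ≤ Real.exp (-2 * Real.log (Y / Q)) := Real.exp_le_exp.mpr h1
      _ = Real.exp (-Real.log (Y / Q)) ^ 2 := by rw [← Real.exp_nat_mul]; ring_nf
      _ = (Q / Y) ^ 2 := by rw [Real.exp_neg, Real.exp_log (div_pos hY0 hQ0), inv_div]
  have hgt : gtilde2 D n = -500 * (∫ z in (0.5 : ℝ)..0.502, gW D (bigP D ^ z / Y)) +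
      500 * (∫ z in (0.502 : ℝ)..0.504, gW D (bigP D ^ z / Y)) := by
    rw [gtilde2_eq_gtilde1_scaleJ2 hD2, ← hY, gtilde1]
  calc ‖pc χ x n * (gtilde2 D n : ℂ) * (n : ℂ) ^ (-s)‖
      = ‖pc χ x n‖ * |gtilde2 D n| * ‖(n : ℂ) ^ (-s)‖ := by
        rw [norm_mul, norm_mul, Complex.norm_real, Real.norm_eq_abs]
    _ ≤ 1 * (2 * gW D (Q / Y)) * 1 := by
        rw [hgt]
        exact mul_le_mul (mul_le_mul (norm_pc_le_one χ x n) hw (abs_nonneg _) zero_le_one)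
          (norm_cpow_neg_le_one hn0 hs) (norm_nonneg _) (by linarith [hgQY])
    _ ≤ 2 * (1 / 2 * (Q / Y) ^ 2) := by nlinarith [hG.trans (by nlinarith [hexp] : _ ≤ 1 / 2 * (Q / Y) ^ 2)]
    _ = R ^ 2 * (1 / (n : ℝ) ^ 2) := by rw [hQYeq]; field_simp

/-- **`Z22:§11.u021`'s first input, PROVED as an implication: `Eq115J2` from Lemma 11.1 and the
`J₂`-tails** — Lemma 11.1 (`Skeleton.Lemma111`; only (11.2)) applied at `Yₙ = nP^{0.004}/(Dt₀)` via
`g̃₂(n) = g̃₁(Yₙ)`, `f̃(log n/log P + 0.004 − α̃) = f̃(log Yₙ/log P)`, plus `TailsJ2`. This is the kernel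
content of "Similarly" for the (11.5)-step. [Z22 p.64, tex L3306]
[cite: Zhang2022LandauSiegel, §11 p. 64] -/
theorem eq115J2_of (h111 : Lemma111) (htail : TailsJ2) : Eq115J2 := by
  obtain ⟨c, hc, C, h⟩ := h111
  have h2 : ForAllLarge fun D _ _ => 2 ≤ D := ⟨2, fun D _ _ hD _ _ => hD⟩
  have h112 : ∃ c : ℝ, 0 < c ∧ ∃ C : ℝ, ForAllLarge fun D _ _ => ∀ y : ℝ,
      (bigP D ^ (0.5 : ℝ) * etaPM D 1 ≤ scaleJ2 D y ∧
          scaleJ2 D y ≤ bigP D ^ (0.502 : ℝ) * etaPM D (-1)) ∨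
        (bigP D ^ (0.502 : ℝ) * etaPM D 1 ≤ scaleJ2 D y ∧
          scaleJ2 D y ≤ bigP D ^ (0.504 : ℝ) * etaPM D (-1)) →
        |ftilde (Real.log (scaleJ2 D y) / Real.log (bigP D)) - gtilde2 D y| ≤
          C * Real.exp (-c * ell D ^ 10) := by
    refine ⟨c, hc, C, (h.and h2).mono fun D _ χ _ _ hD y hy => ?_⟩
    rw [gtilde2_eq_gtilde1_scaleJ2 hD.2]
    exact (hD.1 (scaleJ2 D y)).1 hy
  have hsum : ForAllLarge fun D _ χ => ∀ x : Chr D, ∀ s : ℂ, s.re = 1 / 2 →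
      Summable fun n : ℕ => pc χ x n * (gtilde2 D n : ℂ) * (n : ℂ) ^ (-s) :=
    ⟨9, fun _ _ χ hD _ _ x _ hs => summable_Jtilde2 χ hD x hs⟩
  obtain ⟨c', hc', C', D₀, hcore⟩ := eq115J2_core gtilde2 h112 htail hsum
  refine ⟨c', hc', C', max D₀ 2, fun D _ χ hD hq hp hA x s hs => ?_⟩
  have hD2 : 2 ≤ D := le_trans (le_max_right _ _) hD
  have hs0 : s ≠ 0 := by
    intro h0; rw [h0, Complex.zero_re] at hs; norm_num at hs
  have key := hcore D χ (le_trans (le_max_left _ _) hD) hq hp hA x s hs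
  have hI2 : frakI2Sum χ x s = ∑ n ∈ frakI2Nat D, pc χ x n * (n : ℂ) ^ (-s) *
      ((ftilde (Real.log (scaleJ2 D n) / Real.log (bigP D)) : ℂ) - (gtilde2 D n : ℂ)) := by
    rw [frakI2Sum]
    refine Finset.sum_congr rfl fun n hn => ?_
    have hn1 : 0 < n := by
      classical
      rw [frakI2Nat, Finset.mem_filter, Finset.mem_Icc] at hn
      exact hn.1.1
    rw [tentArg_J2_eq hD2 (by exact_mod_cast hn1)]
  rw [J2_eq_finsum_scaleJ2 χ hD2 x hs0, hI2]
  exact key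

/-- **`Eq115J2` from Lemma 11.1 alone** (the tails being proved: `tailsJ2_holds`); with the tree's
kernel proof of Lemma 11.1 (`Typed.Sec11A.lemma111_of_P`, sz-d33/L3-t3) this closes the first input
of `Z22:§11.u021` outright (assembled in `Section11Eq115.lean`, which may import `TypedSection11A`).
[Z22 p.64, tex L3306] [cite: Zhang2022LandauSiegel, §11 p. 64] -/
theorem eq115J2_of_lemma111 (h111 : Lemma111) : Eq115J2 := eq115J2_of h111 tailsJ2_holds

end J2Chain

end Literature.NumberTheory.LFunctions.Zhang2022.Typed.TypedSection11B
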